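import Literature.Computability.Complexity.StackUnary
import Literature.Computability.Complexity.StackUnaryBits
import Literature.Computability.Complexity.BranchingFn
import Mathlib.Data.Nat.Size
import HarnessLib

/-!
# Stack-program bricks for Liu–Pass's heuristic `ℋ` (Thm 4.1): the index field of the queries

Trunk `CplxCore` toolkit entries (structured stack programs `Com`, `Com.mem_FP`; generic bricks of
`StackUnary.lean` / `StackUnaryBits.lean`) serving the efficiency fact
`Literature.Computability.Cryptography.liuPassHeur_isPPT` of `LiuPassWeakOWF.lean` (Liu–Pass, FOCS 2020, proof of
Thm 4.1: the heuristic `ℋ` queries the inverter on `⟨1ᴸ, ⟨1ᴸ, ⟨i, 1z⟩⟩⟩` for all `i ≤ n + c`, the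
index `i` "represented as a `⌈log(n+c)⌉` bit string" — in the tree, the width-`Nat.size L`
little-endian field `natBits (Nat.size L) i`). The round structure of `ℋ` is assembled from `FP`
bricks elsewhere; the only arithmetic that needs a program is small and is provided here on
*simple* inputs:

* `nbFn ⟨1ᴸ, 1ⁱ⟩ = natBits (Nat.size L) i` (`nbFn_boolPair`; `nbFn ∈ FP`, `nbFn_mem_FP`): parse the
  pair into counters, `⌊log₂ L⌋` by `Com.logCount`, `+1` iff `L ≥ 1` (`Nat.size L = ⌊log₂ L⌋ + 1`),
  then `Com.digitsLoop` (parity halvings) and a final pour (digits least significant first);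
* `Com.parse3U` / `Com.lvl2` / `Com.cntRest` — register-generic parsers of nested unary tuples
  `⟨1ᵃ, ⟨1ᵇ, 1ᶜ⟩⟩` / `⟨1ᵇ, w⟩` into counters (`Com.runs_parse3U`, `Com.runs_lvl2`, `Com.spec3_boolPair`,
  `Com.spec2_boolPair`), used by `nbFn` (two levels) and the next two programs (three levels);
* `updFn ⟨1ᶠ, ⟨1ᵗ, 1ᵛ⟩⟩` (`updFn_boolPair`, `updFn_mem_FP`): the found-flag / first-hit update of one
  round of `ℋ` — frozen `⟨1¹, 1ᵛ⟩` once found or hit, else `⟨1⁰, 1ᵛ⁺¹⟩`;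
* `outFn c ⟨1ᶠ, ⟨1ᵛ, 1ⁿ⟩⟩ = encodeNat (if f = 0 then n + c + 1 else v)` (`outFn_boolPair`,
  `outFn_mem_FP`): the final `minD (n+c+1) …` of `ℋ` in binary (`Com.toBin`);
* `initLFn c j z = 1^{baseLen (n+c) (2(n+c)+3) + j}`, `n = |z|` (`initLFn_mem_FP`): the common query
  length parameter `L = lpBase c n + j` by an upward search maintaining `Nat.size` incrementally
  (`size_succ_eq`: it grows exactly at powers of two), with `baseLen` the least admissible length
  (`LPH.INIT.baseLen_adm`: least `L` with `n + c + Nat.size L = L`, else the bound);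
* the one-state transducer `unitFn` (`[b] ↦ 1^{[b]}`, `unitFn_mem_FP`); `List.cons true` and the
  constant `[]` are `cons_mem_FP` / `const_mem_FP` of `BranchingFn.lean`.

## References

* Y. Liu, R. Pass, *On one-way functions and Kolmogorov complexity*, FOCS 2020
  (arXiv:2009.11514), proof of Thm 4.1 (the queries `𝒜(i ‖ z)`, `i ∈ [n + c]`).
* S. Arora, B. Barak, *Computational Complexity: A Modern Approach*, CUP 2009, §1.3, Thm. 2.8.
-/

namespace Literature.Computability.Cryptography

open _root_.Computability

/-! ### A generic parser for nested unary triples `⟨1ᵃ, ⟨1ᵇ, 1ᶜ⟩⟩` -/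

section Com
open Literature.Computability.Complexity (Com)
open Literature.Computability.Complexity.Com

section Parse3

variable {ι : Type} [DecidableEq ι]

/-- Count the rest of `inp` in `c`. [folklore] -/
def _root_.Literature.Computability.Complexity.Com.cntRest (inp c : ι) : Com ι := loop inp (push c true) (push c true)

/-- Second level: pairs `11`/`00` are units of `b`, `01` starts the last component. [folklore] -/
def _root_.Literature.Computability.Complexity.Com.lvl2 (inp b c : ι) : Com ι :=
  loop inp (pop inp (push b true) skip skip) (pop inp (cntRest inp c) (push b true) skip)

/-- `parse3U inp a b c`: parse `⟨1ᵃ, ⟨1ᵇ, 1ᶜ⟩⟩` into three counters (bit values are ignored: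
every doubled pair is a unit, the separator `01` descends one level, the last component is
counted). [folklore] -/
def _root_.Literature.Computability.Complexity.Com.parse3U (inp a b c : ι) : Com ι :=
  loop inp (pop inp (push a true) skip skip) (pop inp (lvl2 inp b c) (push a true) skip)

/-- Functional semantics of `lvl2`. [folklore] -/
def _root_.Literature.Computability.Complexity.Com.spec2 : List Bool → ℕ → ℕ × ℕ
  | [], B => (B, 0)
  | [_], B => (B, 0)
  | true :: true :: z, B => spec2 z (B + 1)
  | true :: false :: z, B => spec2 z B
  | false :: false :: z, B => spec2 z (B + 1)
  | false :: true :: z, B => (B, z.length)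

/-- Functional semantics of `parse3U`. [folklore] -/
def _root_.Literature.Computability.Complexity.Com.spec3 : List Bool → ℕ → ℕ × ℕ × ℕ
  | [], A => (A, 0, 0)
  | [_], A => (A, 0, 0)
  | true :: true :: z, A => spec3 z (A + 1)
  | true :: false :: z, A => spec3 z A
  | false :: false :: z, A => spec3 z (A + 1)
  | false :: true :: z, A => (A, spec2 z 0)

/-- Semantics of `cntRest` (cost `3|w| + 1`). [folklore] -/
theorem _root_.Literature.Computability.Complexity.Com.runs_cntRest {inp c : ι} (hic : inp ≠ c) : ∀ (w : List Bool) (C : ℕ) (R : Complexity.Regs ι), R inp = w → R c = Complexity.ones C →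
    Runs (cntRest inp c) R (Function.update (Function.update R inp []) c (Complexity.ones (w.length + C))) (3 * w.length + 1)
  | [], C, R, hi, hc => by
    refine (Runs.loop_nil _ _ hi).of_eq ?_ (by simp)
    ext i : 1
    simp only [Function.update_apply, List.length_nil, Nat.zero_add]
    split_ifs <;> simp_all
  | x :: w, C, R, hi, hc => by
    have hbody : Runs (push c true) (Function.update R inp w) (Function.update (Function.update R inp w) c (Complexity.ones (C + 1))) 1 :=
      (Runs.push c true _).of_eq (by simp [Function.update_of_ne hic.symm, hc, ones_succ]) le_rfl
    have ih := runs_cntRest hic w (C + 1) (Function.update (Function.update R inp w) c (Complexity.ones (C + 1)))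
      (by simp [Function.update_of_ne hic]) (by simp)
    rw [show 3 * (x :: w).length + 1 = 1 + 2 + (3 * w.length + 1) by simp; ring]
    have hfin : Function.update (Function.update (Function.update (Function.update R inp w) c (Complexity.ones (C + 1))) inp [])
          c (Complexity.ones (w.length + (C + 1))) = Function.update (Function.update R inp []) c (Complexity.ones ((x :: w).length + C)) := by
      ext i : 1
      simp only [Function.update_apply, List.length_cons, show w.length + (C + 1) = w.length + 1 + C by ring]
      split_ifs <;> simp_all
    cases x
    · exact Runs.loop_false hi hbody (ih.congr hfin)
    · exact Runs.loop_true hi hbody (ih.congr hfin)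

/-- **Semantics of `lvl2`** (cost `≤ 5|z| + 3`). [folklore] -/
theorem _root_.Literature.Computability.Complexity.Com.runs_lvl2 {inp b c : ι} (hib : inp ≠ b) (hic : inp ≠ c) (hbc : b ≠ c) : ∀ (z : List Bool) (B : ℕ) (R : Complexity.Regs ι),
    R inp = z → R b = Complexity.ones B → R c = [] →
    Runs (lvl2 inp b c) R
      (Function.update (Function.update (Function.update R inp []) b (Complexity.ones (spec2 z B).1)) c (Complexity.ones (spec2 z B).2))
      (5 * z.length + 3)
  | [], B, R, hi, hb, hc => by
    refine (Runs.loop_nil _ _ hi).of_eq ?_ (by simp)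
    ext i : 1
    simp only [Function.update_apply, spec2]
    split_ifs <;> simp_all
  | [x], B, R, hi, hb, hc => by
    have hbody : ∀ ct cf : Com ι, Runs (pop inp ct cf skip) (Function.update R inp []) (Function.update R inp []) (0 + 2) :=
      fun ct cf => Runs.pop_nil _ _ (by simp) (Runs.skip _)
    have hrest : Runs (lvl2 inp b c) (Function.update R inp []) (Function.update R inp []) 1 := Runs.loop_nil _ _ (by simp)
    have hfin : Function.update R inp [] =
        Function.update (Function.update (Function.update R inp []) b (Complexity.ones (spec2 [x] B).1)) c (Complexity.ones (spec2 [x] B).2) := by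
      ext i : 1
      simp only [Function.update_apply, spec2]
      split_ifs <;> simp_all
    refine Runs.of_eq ?_ hfin (show (0 + 2) + 2 + 1 ≤ 5 * [x].length + 3 by simp)
    cases x
    · exact Runs.loop_false hi (hbody _ _) hrest
    · exact Runs.loop_true hi (hbody _ _) hrest
  | true :: true :: z, B, R, hi, hb, hc => by
    have hbody : Runs (pop inp (push b true) skip skip) (Function.update R inp (true :: z))
        (Function.update (Function.update R inp z) b (Complexity.ones (B + 1))) (1 + 2) := by
      refine Runs.pop_true _ _ (show Function.update R inp (true :: z) inp = true :: z by simp)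
        ((Runs.push b true _).of_eq ?_ le_rfl)
      rw [Function.update_idem]
      simp [Function.update_of_ne hib.symm, hb, ones_succ]
    have ih := runs_lvl2 hib hic hbc z (B + 1) (Function.update (Function.update R inp z) b (Complexity.ones (B + 1)))
      (by simp [Function.update_of_ne hib]) (by simp) (by simp [Function.update_of_ne hbc.symm, Function.update_of_ne hic.symm, hc])
    simp only [spec2]
    refine (Runs.loop_true hi hbody (ih.of_eq ?_ le_rfl)).of_eq rfl (by simp; omega)
    ext i : 1
    simp only [Function.update_apply]
    split_ifs <;> simp_all
  | true :: false :: z, B, R, hi, hb, hc => by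
    have hbody : Runs (pop inp (push b true) skip skip) (Function.update R inp (false :: z))
        (Function.update R inp z) (0 + 2) :=
      Runs.pop_false _ _ (show Function.update R inp (false :: z) inp = false :: z by simp)
        ((Runs.skip _).of_eq (by rw [Function.update_idem]) le_rfl)
    have ih := runs_lvl2 hib hic hbc z B (Function.update R inp z) (by simp) (by simp [Function.update_of_ne hib.symm, hb])
      (by simp [Function.update_of_ne hic.symm, hc])
    simp only [spec2]
    refine (Runs.loop_true hi hbody (ih.of_eq ?_ le_rfl)).of_eq rfl (by simp; omega)
    ext i : 1
    simp only [Function.update_apply]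
    split_ifs <;> simp_all
  | false :: false :: z, B, R, hi, hb, hc => by
    have hbody : Runs (pop inp (cntRest inp c) (push b true) skip) (Function.update R inp (false :: z))
        (Function.update (Function.update R inp z) b (Complexity.ones (B + 1))) (1 + 2) := by
      refine Runs.pop_false _ _ (show Function.update R inp (false :: z) inp = false :: z by simp)
        ((Runs.push b true _).of_eq ?_ le_rfl)
      rw [Function.update_idem]
      simp [Function.update_of_ne hib.symm, hb, ones_succ]
    have ih := runs_lvl2 hib hic hbc z (B + 1) (Function.update (Function.update R inp z) b (Complexity.ones (B + 1)))
      (by simp [Function.update_of_ne hib]) (by simp) (by simp [Function.update_of_ne hbc.symm, Function.update_of_ne hic.symm, hc])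
    simp only [spec2]
    refine (Runs.loop_false hi hbody (ih.of_eq ?_ le_rfl)).of_eq rfl (by simp; omega)
    ext i : 1
    simp only [Function.update_apply]
    split_ifs <;> simp_all
  | false :: true :: z, B, R, hi, hb, hc => by
    have hcnt := runs_cntRest hic z 0 (Function.update (Function.update R inp (true :: z)) inp z)
      (by simp) (by simp [Function.update_of_ne hic.symm, hc])
    rw [Nat.add_zero] at hcnt
    have hbody := Runs.pop_true (push b true) skip (show Function.update R inp (true :: z) inp = true :: z by simp) hcnt
    simp only [spec2]
    refine (Runs.loop_false hi hbody (Runs.loop_nil _ _ (by simp [Function.update_of_ne hic]))).of_eq ?_ (by simp; omega)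
    ext i : 1
    simp only [Function.update_apply]
    split_ifs <;> simp_all

/-- **Semantics of `parse3U`** (cost `≤ 5|z| + 5`). [folklore] -/
theorem _root_.Literature.Computability.Complexity.Com.runs_parse3U {inp a b c : ι} (hia : inp ≠ a) (hib : inp ≠ b) (hic : inp ≠ c) (hab : a ≠ b) (hac : a ≠ c) (hbc : b ≠ c) :
    ∀ (z : List Bool) (A : ℕ) (R : Complexity.Regs ι), R inp = z → R a = Complexity.ones A → R b = [] → R c = [] →
    Runs (parse3U inp a b c) R
      (Function.update (Function.update (Function.update (Function.update R inp []) a (Complexity.ones (spec3 z A).1)) b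
        (Complexity.ones (spec3 z A).2.1)) c (Complexity.ones (spec3 z A).2.2)) (5 * z.length + 5)
  | [], A, R, hi, ha, hb, hc => by
    refine (Runs.loop_nil _ _ hi).of_eq ?_ (by simp)
    ext i : 1
    simp only [Function.update_apply, spec3]
    split_ifs <;> simp_all
  | [x], A, R, hi, ha, hb, hc => by
    have hbody : ∀ ct cf : Com ι, Runs (pop inp ct cf skip) (Function.update R inp []) (Function.update R inp []) (0 + 2) :=
      fun ct cf => Runs.pop_nil _ _ (by simp) (Runs.skip _)
    have hrest : Runs (parse3U inp a b c) (Function.update R inp []) (Function.update R inp []) 1 := Runs.loop_nil _ _ (by simp)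
    have hfin : Function.update R inp [] = Function.update (Function.update (Function.update (Function.update R inp [])
        a (Complexity.ones (spec3 [x] A).1)) b (Complexity.ones (spec3 [x] A).2.1)) c (Complexity.ones (spec3 [x] A).2.2) := by
      ext i : 1
      simp only [Function.update_apply, spec3]
      split_ifs <;> simp_all
    refine Runs.of_eq ?_ hfin (show (0 + 2) + 2 + 1 ≤ 5 * [x].length + 5 by simp)
    cases x
    · exact Runs.loop_false hi (hbody _ _) hrest
    · exact Runs.loop_true hi (hbody _ _) hrest
  | true :: true :: z, A, R, hi, ha, hb, hc => by
    have hbody : Runs (pop inp (push a true) skip skip) (Function.update R inp (true :: z))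
        (Function.update (Function.update R inp z) a (Complexity.ones (A + 1))) (1 + 2) := by
      refine Runs.pop_true _ _ (show Function.update R inp (true :: z) inp = true :: z by simp)
        ((Runs.push a true _).of_eq ?_ le_rfl)
      rw [Function.update_idem]
      simp [Function.update_of_ne hia.symm, ha, ones_succ]
    have ih := runs_parse3U hia hib hic hab hac hbc z (A + 1) (Function.update (Function.update R inp z) a (Complexity.ones (A + 1)))
      (by simp [Function.update_of_ne hia]) (by simp) (by simp [Function.update_of_ne hab.symm, Function.update_of_ne hib.symm, hb])
      (by simp [Function.update_of_ne hac.symm, Function.update_of_ne hic.symm, hc])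
    simp only [spec3]
    refine (Runs.loop_true hi hbody (ih.of_eq ?_ le_rfl)).of_eq rfl (by simp; omega)
    ext i : 1
    simp only [Function.update_apply]
    split_ifs <;> simp_all
  | true :: false :: z, A, R, hi, ha, hb, hc => by
    have hbody : Runs (pop inp (push a true) skip skip) (Function.update R inp (false :: z))
        (Function.update R inp z) (0 + 2) :=
      Runs.pop_false _ _ (show Function.update R inp (false :: z) inp = false :: z by simp)
        ((Runs.skip _).of_eq (by rw [Function.update_idem]) le_rfl)
    have ih := runs_parse3U hia hib hic hab hac hbc z A (Function.update R inp z) (by simp) (by simp [Function.update_of_ne hia.symm, ha])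
      (by simp [Function.update_of_ne hib.symm, hb]) (by simp [Function.update_of_ne hic.symm, hc])
    simp only [spec3]
    refine (Runs.loop_true hi hbody (ih.of_eq ?_ le_rfl)).of_eq rfl (by simp; omega)
    ext i : 1
    simp only [Function.update_apply]
    split_ifs <;> simp_all
  | false :: false :: z, A, R, hi, ha, hb, hc => by
    have hbody : Runs (pop inp (lvl2 inp b c) (push a true) skip) (Function.update R inp (false :: z))
        (Function.update (Function.update R inp z) a (Complexity.ones (A + 1))) (1 + 2) := by
      refine Runs.pop_false _ _ (show Function.update R inp (false :: z) inp = false :: z by simp)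
        ((Runs.push a true _).of_eq ?_ le_rfl)
      rw [Function.update_idem]
      simp [Function.update_of_ne hia.symm, ha, ones_succ]
    have ih := runs_parse3U hia hib hic hab hac hbc z (A + 1) (Function.update (Function.update R inp z) a (Complexity.ones (A + 1)))
      (by simp [Function.update_of_ne hia]) (by simp) (by simp [Function.update_of_ne hab.symm, Function.update_of_ne hib.symm, hb])
      (by simp [Function.update_of_ne hac.symm, Function.update_of_ne hic.symm, hc])
    simp only [spec3]
    refine (Runs.loop_false hi hbody (ih.of_eq ?_ le_rfl)).of_eq rfl (by simp; omega)
    ext i : 1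
    simp only [Function.update_apply]
    split_ifs <;> simp_all
  | false :: true :: z, A, R, hi, ha, hb, hc => by
    have h2 := runs_lvl2 hib hic hbc z 0 (Function.update (Function.update R inp (true :: z)) inp z)
      (by simp) (by simp [Function.update_of_ne hib.symm, hb]) (by simp [Function.update_of_ne hic.symm, hc])
    have hbody := Runs.pop_true (push a true) skip (show Function.update R inp (true :: z) inp = true :: z by simp) h2
    simp only [spec3]
    have hrest := Runs.loop_nil (k := inp) (pop inp (push a true) skip skip) (pop inp (lvl2 inp b c) (push a true) skip)
      (R := Function.update (Function.update (Function.update (Function.update (Function.update R inp (true :: z)) inp z) inp [])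
        b (Complexity.ones (spec2 z 0).1)) c (Complexity.ones (spec2 z 0).2)) (by simp [Function.update_of_ne hic, Function.update_of_ne hib])
    refine (Runs.loop_false hi hbody hrest).of_eq ?_ ?_
    · ext i : 1
      simp only [Function.update_apply]
      split_ifs <;> simp_all
    · simp; omega

/-- `spec2` on `⟨1ᵇ, w⟩`. [folklore] -/
theorem _root_.Literature.Computability.Complexity.Com.spec2_boolPair (b : ℕ) (w : List Bool) (B : ℕ) : spec2 (Complexity.boolPair (Complexity.ones b) w) B = (B + b, w.length) := by
  induction b generalizing B with
  | zero => simp [Complexity.boolPair, spec2]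
  | succ b ih =>
    have hcons : Complexity.boolPair (Complexity.ones (b + 1)) w = true :: true :: Complexity.boolPair (Complexity.ones b) w := by simp [Complexity.boolPair, ones_succ]
    rw [hcons, spec2, ih]; simp only [Prod.mk.injEq, and_true]; omega

/-- `spec3` on `⟨1ᵃ, ⟨1ᵇ, 1ᶜ⟩⟩`. [folklore] -/
theorem _root_.Literature.Computability.Complexity.Com.spec3_boolPair (a b c A : ℕ) : spec3 (Complexity.boolPair (Complexity.ones a) (Complexity.boolPair (Complexity.ones b) (Complexity.ones c))) A = (A + a, b, c) := by
  induction a generalizing A with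
  | zero =>
    rw [show Complexity.boolPair (Complexity.ones 0) (Complexity.boolPair (Complexity.ones b) (Complexity.ones c)) = false :: true :: Complexity.boolPair (Complexity.ones b) (Complexity.ones c) by rfl, spec3,
      spec2_boolPair]
    simp
  | succ a ih =>
    have hcons : Complexity.boolPair (Complexity.ones (a + 1)) (Complexity.boolPair (Complexity.ones b) (Complexity.ones c)) = true :: true :: Complexity.boolPair (Complexity.ones a) (Complexity.boolPair (Complexity.ones b) (Complexity.ones c)) := by
      simp [Complexity.boolPair, ones_succ]
    rw [hcons, spec3, ih]; simp only [Prod.mk.injEq, and_true]; omega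

/-- Sizes after `spec2`. [folklore] -/
theorem _root_.Literature.Computability.Complexity.Com.spec2_le : ∀ (z : List Bool) (B : ℕ), (spec2 z B).1 + (spec2 z B).2 ≤ B + z.length
  | [], B => by simp [spec2]
  | [_], B => by simp [spec2]
  | true :: true :: z, B => by have := spec2_le z (B + 1); simp [spec2] at this ⊢; omega
  | true :: false :: z, B => by have := spec2_le z B; simp [spec2] at this ⊢; omega
  | false :: false :: z, B => by have := spec2_le z (B + 1); simp [spec2] at this ⊢; omega
  | false :: true :: z, B => by simp [spec2]; omega

/-- Sizes after `spec3`. [folklore] -/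
theorem _root_.Literature.Computability.Complexity.Com.spec3_le : ∀ (z : List Bool) (A : ℕ), (spec3 z A).1 + (spec3 z A).2.1 + (spec3 z A).2.2 ≤ A + z.length
  | [], A => by simp [spec3]
  | [_], A => by simp [spec3]
  | true :: true :: z, A => by have := spec3_le z (A + 1); simp [spec3] at this ⊢; omega
  | true :: false :: z, A => by have := spec3_le z A; simp [spec3] at this ⊢; omega
  | false :: false :: z, A => by have := spec3_le z (A + 1); simp [spec3] at this ⊢; omega
  | false :: true :: z, A => by have := spec2_le z 0; simp [spec3] at this ⊢; omega

end Parse3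

end Com

namespace LPH

namespace NB

open Complexity.Com

/-- Registers of the index-field program: input; fuel, value and nonemptiness witness copies of
`L`; the width `D`; the value `i`; halving scratch and parity; reversed digits; output. [folklore] -/
inductive Rg
  | inp | l1 | l2 | l3 | dd | vi | a | par | o | out
  deriving DecidableEq, Fintype

/-- Explicit register files. [folklore] -/
def mk (zi z1 z2 z3 zd zv za zp zo zu : List Bool) : Complexity.Regs Rg := fun r =>
  match r with
  | .inp => zi | .l1 => z1 | .l2 => z2 | .l3 => z3 | .dd => zd | .vi => zv | .a => za | .par => zp | .o => zo
  | .out => zu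

section MkLemmas

variable (zi z1 z2 z3 zd zv za zp zo zu x : List Bool)

/-- Reading `inp`. [folklore] -/
@[simp] theorem mk_inp : mk zi z1 z2 z3 zd zv za zp zo zu .inp = zi := rfl
/-- Reading `l1`. [folklore] -/
@[simp] theorem mk_l1 : mk zi z1 z2 z3 zd zv za zp zo zu .l1 = z1 := rfl
/-- Reading `l2`. [folklore] -/
@[simp] theorem mk_l2 : mk zi z1 z2 z3 zd zv za zp zo zu .l2 = z2 := rfl
/-- Reading `l3`. [folklore] -/
@[simp] theorem mk_l3 : mk zi z1 z2 z3 zd zv za zp zo zu .l3 = z3 := rfl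
/-- Reading `dd`. [folklore] -/
@[simp] theorem mk_dd : mk zi z1 z2 z3 zd zv za zp zo zu .dd = zd := rfl
/-- Reading `vi`. [folklore] -/
@[simp] theorem mk_vi : mk zi z1 z2 z3 zd zv za zp zo zu .vi = zv := rfl
/-- Reading `a`. [folklore] -/
@[simp] theorem mk_a : mk zi z1 z2 z3 zd zv za zp zo zu .a = za := rfl
/-- Reading `par`. [folklore] -/
@[simp] theorem mk_par : mk zi z1 z2 z3 zd zv za zp zo zu .par = zp := rfl
/-- Reading `o`. [folklore] -/
@[simp] theorem mk_o : mk zi z1 z2 z3 zd zv za zp zo zu .o = zo := rfl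
/-- Reading `out`. [folklore] -/
@[simp] theorem mk_out : mk zi z1 z2 z3 zd zv za zp zo zu .out = zu := rfl

/-- Updating `inp`. [folklore] -/
@[simp] theorem update_inp : Function.update (mk zi z1 z2 z3 zd zv za zp zo zu) .inp x = mk x z1 z2 z3 zd zv za zp zo zu := by
  funext r; cases r <;> simp
/-- Updating `l1`. [folklore] -/
@[simp] theorem update_l1 : Function.update (mk zi z1 z2 z3 zd zv za zp zo zu) .l1 x = mk zi x z2 z3 zd zv za zp zo zu := by
  funext r; cases r <;> simp
/-- Updating `l2`. [folklore] -/
@[simp] theorem update_l2 : Function.update (mk zi z1 z2 z3 zd zv za zp zo zu) .l2 x = mk zi z1 x z3 zd zv za zp zo zu := by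
  funext r; cases r <;> simp
/-- Updating `l3`. [folklore] -/
@[simp] theorem update_l3 : Function.update (mk zi z1 z2 z3 zd zv za zp zo zu) .l3 x = mk zi z1 z2 x zd zv za zp zo zu := by
  funext r; cases r <;> simp
/-- Updating `dd`. [folklore] -/
@[simp] theorem update_dd : Function.update (mk zi z1 z2 z3 zd zv za zp zo zu) .dd x = mk zi z1 z2 z3 x zv za zp zo zu := by
  funext r; cases r <;> simp
/-- Updating `vi`. [folklore] -/
@[simp] theorem update_vi : Function.update (mk zi z1 z2 z3 zd zv za zp zo zu) .vi x = mk zi z1 z2 z3 zd x za zp zo zu := by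
  funext r; cases r <;> simp
/-- Updating `a`. [folklore] -/
@[simp] theorem update_a : Function.update (mk zi z1 z2 z3 zd zv za zp zo zu) .a x = mk zi z1 z2 z3 zd zv x zp zo zu := by
  funext r; cases r <;> simp
/-- Updating `par`. [folklore] -/
@[simp] theorem update_par : Function.update (mk zi z1 z2 z3 zd zv za zp zo zu) .par x = mk zi z1 z2 z3 zd zv za x zo zu := by
  funext r; cases r <;> simp
/-- Updating `o`. [folklore] -/
@[simp] theorem update_o : Function.update (mk zi z1 z2 z3 zd zv za zp zo zu) .o x = mk zi z1 z2 z3 zd zv za zp x zu := by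
  funext r; cases r <;> simp
/-- Updating `out`. [folklore] -/
@[simp] theorem update_out : Function.update (mk zi z1 z2 z3 zd zv za zp zo zu) .out x = mk zi z1 z2 z3 zd zv za zp zo x := by
  funext r; cases r <;> simp

end MkLemmas

/-- The initial register file. [folklore] -/
theorem init_eq (z : List Bool) : Complexity.Regs.init Rg.inp z = mk z [] [] [] [] [] [] [] [] [] := by
  funext r; cases r <;> simp [Complexity.Regs.init, mk]

/-! #### Parsing `⟨1ᴸ, 1ⁱ⟩` into counters -/

/-- Three units of `L`. [folklore] -/
def unit3 : Complexity.Com Rg := push .l1 true ;; push .l2 true ;; push .l3 true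

/-- Loop body after a first bit `1`: `11` is a unit of `L`; `10` is malformed (ignored). [folklore] -/
def pT : Complexity.Com Rg := pop .inp unit3 skip skip

/-- Loop body after a first bit `0`: `01` is the separator (count the rest, `Com.cntRest`), `00` a
unit of `L`. [folklore] -/
def pF : Complexity.Com Rg := pop .inp (cntRest .inp .vi) unit3 skip

/-- The parser (functional semantics: `Com.spec2`). [folklore] -/
def parse : Complexity.Com Rg := loop .inp pT pF

/-- Semantics of `unit3` (cost `3`). [folklore] -/
theorem runs_unit3 (zi : List Bool) (N : ℕ) (zd zv za zp zo zu : List Bool) :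
    Runs unit3 (mk zi (Complexity.ones N) (Complexity.ones N) (Complexity.ones N) zd zv za zp zo zu)
      (mk zi (Complexity.ones (N + 1)) (Complexity.ones (N + 1)) (Complexity.ones (N + 1)) zd zv za zp zo zu) (1 + (1 + 1)) := by
  simpa [unit3, ones_succ] using (Runs.push Rg.l1 true (mk zi (Complexity.ones N) (Complexity.ones N) (Complexity.ones N) zd zv za zp zo zu)).seq
    ((Runs.push Rg.l2 true _).seq (Runs.push Rg.l3 true _))

/-- **Semantics of the parser** (cost `≤ 5|z| + 3`). [folklore] -/
theorem runs_parse : ∀ (z : List Bool) (N : ℕ) (zd za zp zo zu : List Bool),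
    Runs parse (mk z (Complexity.ones N) (Complexity.ones N) (Complexity.ones N) zd [] za zp zo zu)
      (mk [] (Complexity.ones (spec2 z N).1) (Complexity.ones (spec2 z N).1) (Complexity.ones (spec2 z N).1) zd (Complexity.ones (spec2 z N).2) za zp zo zu)
      (5 * z.length + 3)
  | [], N, zd, za, zp, zo, zu => by
    have h : Runs parse (mk [] (Complexity.ones N) (Complexity.ones N) (Complexity.ones N) zd [] za zp zo zu) (mk [] (Complexity.ones N) (Complexity.ones N) (Complexity.ones N) zd [] za zp zo zu) 1 :=
      Runs.loop_nil (k := Rg.inp) _ _ rfl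
    simpa [spec2] using h.mono (show 1 ≤ 3 by norm_num)
  | [c], N, zd, za, zp, zo, zu => by
    have hrest : Runs parse (mk [] (Complexity.ones N) (Complexity.ones N) (Complexity.ones N) zd [] za zp zo zu) (mk [] (Complexity.ones N) (Complexity.ones N) (Complexity.ones N) zd [] za zp zo zu) 1 :=
      Runs.loop_nil _ _ rfl
    simp only [spec2]
    refine Runs.mono ?_ (show (0 + 2) + 2 + 1 ≤ 5 * [c].length + 3 by simp)
    cases c
    · exact Runs.loop_false' (w := []) rfl (update_inp ..) (Runs.pop_nil _ _ rfl (Runs.skip _)) hrest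
    · exact Runs.loop_true' (w := []) rfl (update_inp ..) (Runs.pop_nil _ _ rfl (Runs.skip _)) hrest
  | true :: true :: z, N, zd, za, zp, zo, zu => by
    have ih := runs_parse z (N + 1) zd za zp zo zu
    simp only [spec2]
    refine Runs.mono ?_ (show (1 + (1 + 1) + 2) + 2 + (5 * z.length + 3) ≤ 5 * (true :: true :: z).length + 3 by simp; omega)
    exact Runs.loop_true' rfl (update_inp ..) (Runs.pop_true' _ _ rfl (update_inp ..) (runs_unit3 ..)) ih
  | true :: false :: z, N, zd, za, zp, zo, zu => by
    have ih := runs_parse z N zd za zp zo zu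
    simp only [spec2]
    refine Runs.mono ?_ (show (0 + 2) + 2 + (5 * z.length + 3) ≤ 5 * (true :: false :: z).length + 3 by simp; omega)
    exact Runs.loop_true' rfl (update_inp ..) (Runs.pop_false' _ _ rfl (update_inp ..) (Runs.skip _)) ih
  | false :: false :: z, N, zd, za, zp, zo, zu => by
    have ih := runs_parse z (N + 1) zd za zp zo zu
    simp only [spec2]
    refine Runs.mono ?_ (show (1 + (1 + 1) + 2) + 2 + (5 * z.length + 3) ≤ 5 * (false :: false :: z).length + 3 by simp; omega)
    exact Runs.loop_false' rfl (update_inp ..) (Runs.pop_false' _ _ rfl (update_inp ..) (runs_unit3 ..)) ih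
  | false :: true :: z, N, zd, za, zp, zo, zu => by
    have hcnt : Runs (cntRest .inp .vi) (mk z (Complexity.ones N) (Complexity.ones N) (Complexity.ones N) zd [] za zp zo zu)
        (mk [] (Complexity.ones N) (Complexity.ones N) (Complexity.ones N) zd (Complexity.ones z.length) za zp zo zu) (3 * z.length + 1) := by
      have := runs_cntRest (inp := Rg.inp) (c := Rg.vi) (by decide) z 0 (mk z (Complexity.ones N) (Complexity.ones N) (Complexity.ones N) zd [] za zp zo zu) rfl rfl
      simpa using this
    have hrest : Runs parse (mk [] (Complexity.ones N) (Complexity.ones N) (Complexity.ones N) zd (Complexity.ones z.length) za zp zo zu)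
        (mk [] (Complexity.ones N) (Complexity.ones N) (Complexity.ones N) zd (Complexity.ones z.length) za zp zo zu) 1 := Runs.loop_nil _ _ rfl
    simp only [spec2]
    refine Runs.mono ?_ (show ((3 * z.length + 1) + 2) + 2 + 1 ≤ 5 * (false :: true :: z).length + 3 by simp; omega)
    exact Runs.loop_false' rfl (update_inp ..) (Runs.pop_true' _ _ rfl (update_inp ..) hcnt) hrest

/-! #### The program -/

/-- After `⌊log₂ L⌋`, one more unit iff `L ≥ 1` (witnessed by `l3`). [folklore] -/
def sizeFix : Complexity.Com Rg := pop .l3 (push .dd true) (push .dd true) skip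

/-- Semantics of `sizeFix` (cost `≤ 3`). [folklore] -/
theorem runs_sizeFix (L D : ℕ) (zi z1 z2 zv za zp zo zu : List Bool) :
    Runs sizeFix (mk zi z1 z2 (Complexity.ones L) (Complexity.ones D) zv za zp zo zu)
      (mk zi z1 z2 (Complexity.ones (L - 1)) (Complexity.ones (D + if L = 0 then 0 else 1)) zv za zp zo zu) 3 := by
  unfold sizeFix
  rcases L with _ | L
  · simpa using (Runs.pop_nil _ _ (rfl : mk zi z1 z2 (Complexity.ones 0) (Complexity.ones D) zv za zp zo zu .l3 = []) (Runs.skip _)).mono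
      (show 0 + 2 ≤ 3 by norm_num)
  · simpa [ones_succ] using Runs.pop_true' (R := mk zi z1 z2 (Complexity.ones (L + 1)) (Complexity.ones D) zv za zp zo zu) _ _ rfl (update_l3 ..)
      (Runs.push' (update_dd ..))

/-- **The index-field program**: parse, logarithm, size, digits, pour. [folklore] -/
def prog : Complexity.Com Rg := parse ;; logCount .l1 .l2 .a .dd ;; sizeFix ;; digitsLoop .dd .vi .a .par .o ;; pour .o .out

/-- `⌊log₂ L⌋ + [L ≥ 1] = Nat.size L`. [folklore] -/
theorem log_add_eq_size (L : ℕ) : (Nat.log 2 L + if L = 0 then 0 else 1) = Nat.size L := by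
  by_cases h : L = 0
  · subst h; simp
  · rw [if_neg h]
    apply le_antisymm
    · exact Nat.lt_size.2 (Nat.pow_log_le_self 2 h)
    · exact Nat.size_le.2 (Nat.lt_pow_succ_log_self one_lt_two L)

end NB

end LPH

open LPH.NB Complexity.Com in
/-- **The function computed by the index-field program**: with `(L, I)` the parsed counters,
`natBits (Nat.size L) I`. [folklore] -/
def nbFn (w : List Bool) : List Bool :=
  Complexity.natBits (Nat.size (Complexity.Com.spec2 w 0).1) (Complexity.Com.spec2 w 0).2

namespace LPH.NB

open Complexity.Com

/-- **Semantics of the whole program** (cost `≤ 14|z|² + 40|z| + 12`). [folklore] -/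
theorem runs_prog (z : List Bool) :
    ∃ R', Runs prog (Complexity.Regs.init Rg.inp z) R' (14 * z.length ^ 2 + 40 * z.length + 12) ∧ R' .out = nbFn z := by
  rw [init_eq]
  set L := (spec2 z 0).1 with hL
  set I := (spec2 z 0).2 with hI
  have hle := spec2_le z 0
  rw [← hL, ← hI, Nat.zero_add] at hle
  have h1 : Runs parse (mk z [] [] [] [] [] [] [] [] []) (mk [] (Complexity.ones L) (Complexity.ones L) (Complexity.ones L) [] (Complexity.ones I) [] [] [] []) (5 * z.length + 3) := by
    have := runs_parse z 0 [] [] [] [] []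
    rwa [← hL, ← hI] at this
  have h2 : Runs (logCount .l1 .l2 .a .dd) (mk [] (Complexity.ones L) (Complexity.ones L) (Complexity.ones L) [] (Complexity.ones I) [] [] [] [])
      (mk [] [] [] (Complexity.ones L) (Complexity.ones (Nat.log 2 L)) (Complexity.ones I) [] [] [] []) (L * (7 * L + 13) + 1) := by
    have := runs_logCount (f := Rg.l1) (v := Rg.l2) (a := Rg.a) (d := Rg.dd) (by decide) (by decide) (by decide) (by decide)
      (by decide) (by decide) L L 0 (mk [] (Complexity.ones L) (Complexity.ones L) (Complexity.ones L) [] (Complexity.ones I) [] [] [] []) rfl rfl rfl rfl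
    rw [logC_snd L L 0 le_rfl, logC_fst L L 0 le_rfl, Nat.zero_add] at this
    simpa using this
  have h3 := runs_sizeFix L (Nat.log 2 L) [] [] [] (Complexity.ones I) [] [] [] []
  rw [log_add_eq_size] at h3
  have h4 : Runs (digitsLoop .dd .vi .a .par .o) (mk [] [] [] (Complexity.ones (L - 1)) (Complexity.ones (Nat.size L)) (Complexity.ones I) [] [] [] [])
      (mk [] [] [] (Complexity.ones (L - 1)) [] (Complexity.ones (I / 2 ^ Nat.size L)) [] [] (Complexity.natBits (Nat.size L) I).reverse [])
      (Nat.size L * (7 * I + 8) + 1) := by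
    have := runs_digitsLoop (dd := Rg.dd) (vi := Rg.vi) (a := Rg.a) (par := Rg.par) (o := Rg.o) (by decide) (by decide)
      (by decide) (by decide) (by decide) (by decide) (by decide) (by decide) (by decide) (by decide) (Nat.size L) I
      (mk [] [] [] (Complexity.ones (L - 1)) (Complexity.ones (Nat.size L)) (Complexity.ones I) [] [] [] []) rfl rfl rfl rfl
    simpa using this
  have h5 : Runs (pour .o .out) (mk [] [] [] (Complexity.ones (L - 1)) [] (Complexity.ones (I / 2 ^ Nat.size L)) [] [] (Complexity.natBits (Nat.size L) I).reverse [])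
      (mk [] [] [] (Complexity.ones (L - 1)) [] (Complexity.ones (I / 2 ^ Nat.size L)) [] [] [] (Complexity.natBits (Nat.size L) I)) (3 * Nat.size L + 1) := by
    have := runs_pour (a := Rg.o) (b := Rg.out) (by decide)
      (mk [] [] [] (Complexity.ones (L - 1)) [] (Complexity.ones (I / 2 ^ Nat.size L)) [] [] (Complexity.natBits (Nat.size L) I).reverse [])
    simpa using this
  refine ⟨_, (h1.seq (h2.seq (h3.seq (h4.seq h5)))).mono ?_, by simp [nbFn, ← hL, ← hI]⟩
  have hS : Nat.size L ≤ L := Nat.size_le.2 Nat.lt_two_pow_self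
  have hLz : L ≤ z.length := by omega
  have hIz : I ≤ z.length := by omega
  have e2 : L * (7 * L + 13) ≤ z.length * (7 * z.length + 13) := Nat.mul_le_mul hLz (by omega)
  have e4 : Nat.size L * (7 * I + 8) ≤ z.length * (7 * z.length + 8) := Nat.mul_le_mul (hS.trans hLz) (by omega)
  have e5 : z.length * (7 * z.length + 13) + z.length * (7 * z.length + 8) = 14 * z.length ^ 2 + 21 * z.length := by ring
  omega

end LPH.NB

/-! ### The state update `⟨1ᶠ, ⟨1ᵗ, 1ᵛ⟩⟩ ↦ ⟨1^{f ∨ t}, 1^{v + [¬f ∧ ¬t]}⟩` -/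

namespace LPH.UPD

open Complexity.Com

/-- Registers of the update program. [folklore] -/
inductive Rg
  | inp | a | b | c | out
  deriving DecidableEq, Fintype

/-- Explicit register files. [folklore] -/
def mk (zi za zb zc zo : List Bool) : Complexity.Regs Rg := fun r =>
  match r with
  | .inp => zi | .a => za | .b => zb | .c => zc | .out => zo

section MkLemmas
variable (zi za zb zc zo x : List Bool)
/-- Reading `inp`. [folklore] -/
@[simp] theorem mk_inp : mk zi za zb zc zo .inp = zi := rfl
/-- Reading `a`. [folklore] -/
@[simp] theorem mk_a : mk zi za zb zc zo .a = za := rfl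
/-- Reading `b`. [folklore] -/
@[simp] theorem mk_b : mk zi za zb zc zo .b = zb := rfl
/-- Reading `c`. [folklore] -/
@[simp] theorem mk_c : mk zi za zb zc zo .c = zc := rfl
/-- Reading `out`. [folklore] -/
@[simp] theorem mk_out : mk zi za zb zc zo .out = zo := rfl
/-- Updating `inp`. [folklore] -/
@[simp] theorem update_inp : Function.update (mk zi za zb zc zo) .inp x = mk x za zb zc zo := by funext r; cases r <;> simp
/-- Updating `a`. [folklore] -/
@[simp] theorem update_a : Function.update (mk zi za zb zc zo) .a x = mk zi x zb zc zo := by funext r; cases r <;> simp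
/-- Updating `b`. [folklore] -/
@[simp] theorem update_b : Function.update (mk zi za zb zc zo) .b x = mk zi za x zc zo := by funext r; cases r <;> simp
/-- Updating `c`. [folklore] -/
@[simp] theorem update_c : Function.update (mk zi za zb zc zo) .c x = mk zi za zb x zo := by funext r; cases r <;> simp
/-- Updating `out`. [folklore] -/
@[simp] theorem update_out : Function.update (mk zi za zb zc zo) .out x = mk zi za zb zc x := by funext r; cases r <;> simp
end MkLemmas

/-- The initial register file. [folklore] -/
theorem init_eq (z : List Bool) : Complexity.Regs.init Rg.inp z = mk z [] [] [] [] := by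
  funext r; cases r <;> simp [Complexity.Regs.init, mk]

/-- Emit the frozen state `⟨1¹, 1ᵛ⟩` on top of `1ᵛ`. [folklore] -/
def found : Complexity.Com Rg := push .out true ;; push .out false ;; push .out true ;; push .out true

/-- Emit the searching state `⟨1⁰, 1ᵛ⁺¹⟩` on top of `1ᵛ`. [folklore] -/
def none : Complexity.Com Rg := push .out true ;; push .out true ;; push .out false

/-- **The update program.** [folklore] -/
def prog : Complexity.Com Rg := parse3U .inp .a .b .c ;; pour .c .out ;; pop .a found found (pop .b found found none)

/-- The new state from the parsed counters `(f, t, v)`. [folklore] -/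
def updOut (p : ℕ × ℕ × ℕ) : List Bool :=
  if p.1 = 0 ∧ p.2.1 = 0 then Complexity.boolPair (Complexity.ones 0) (Complexity.ones (p.2.2 + 1)) else Complexity.boolPair (Complexity.ones 1) (Complexity.ones p.2.2)

/-- Semantics of `found` (cost `4`). [folklore] -/
theorem runs_found (zi za zb zc zo : List Bool) :
    Runs found (mk zi za zb zc zo) (mk zi za zb zc (true :: true :: false :: true :: zo)) (1 + (1 + (1 + 1))) := by
  simpa [found] using (Runs.push Rg.out true (mk zi za zb zc zo)).seq ((Runs.push Rg.out false _).seq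
    ((Runs.push Rg.out true _).seq (Runs.push Rg.out true _)))

/-- Semantics of `none` (cost `3`). [folklore] -/
theorem runs_none (zi za zb zc zo : List Bool) :
    Runs none (mk zi za zb zc zo) (mk zi za zb zc (false :: true :: true :: zo)) (1 + (1 + 1)) := by
  simpa [none] using (Runs.push Rg.out true (mk zi za zb zc zo)).seq ((Runs.push Rg.out true _).seq (Runs.push Rg.out false _))

/-- **Semantics of the update program** (cost `≤ 8|z| + 14`). [folklore] -/
theorem runs_prog (z : List Bool) :
    ∃ R', Runs prog (Complexity.Regs.init Rg.inp z) R' (8 * z.length + 14) ∧ R' .out = updOut (spec3 z 0) := by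
  rw [init_eq]
  set f := (spec3 z 0).1 with hf
  set t := (spec3 z 0).2.1 with ht
  set v := (spec3 z 0).2.2 with hv
  have hle := spec3_le z 0
  rw [← hf, ← ht, ← hv, Nat.zero_add] at hle
  have h1 : Runs (parse3U .inp .a .b .c) (mk z [] [] [] []) (mk [] (Complexity.ones f) (Complexity.ones t) (Complexity.ones v) []) (5 * z.length + 5) := by
    have := runs_parse3U (inp := Rg.inp) (a := Rg.a) (b := Rg.b) (c := Rg.c) (by decide) (by decide) (by decide) (by decide)
      (by decide) (by decide) z 0 (mk z [] [] [] []) rfl rfl rfl rfl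
    simpa using this
  have h2 : Runs (pour .c .out) (mk [] (Complexity.ones f) (Complexity.ones t) (Complexity.ones v) []) (mk [] (Complexity.ones f) (Complexity.ones t) [] (Complexity.ones v)) (3 * v + 1) := by
    have := runs_pour (a := Rg.c) (b := Rg.out) (by decide) (mk [] (Complexity.ones f) (Complexity.ones t) (Complexity.ones v) [])
    simpa using this
  have h3 : Runs (pop .a found found (pop .b found found none)) (mk [] (Complexity.ones f) (Complexity.ones t) [] (Complexity.ones v))
      (mk [] (Complexity.ones (f - 1)) (Complexity.ones (if f = 0 then t - 1 else t)) [] (updOut (f, t, v))) 8 := by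
    rcases f with _ | f
    · rcases t with _ | t
      · simpa [updOut, Complexity.boolPair, ones_succ] using (Runs.pop_nil _ _ (rfl : mk [] (Complexity.ones 0) (Complexity.ones 0) [] (Complexity.ones v) .a = [])
          ((Runs.pop_nil _ _ (rfl : mk [] (Complexity.ones 0) (Complexity.ones 0) [] (Complexity.ones v) .b = []) (runs_none ..)).mono (show _ ≤ 6 by norm_num))).mono
          (show 6 + 2 ≤ 8 by norm_num)
      · simpa [updOut, Complexity.boolPair, ones_succ] using (Runs.pop_nil _ _ (rfl : mk [] (Complexity.ones 0) (Complexity.ones (t + 1)) [] (Complexity.ones v) .a = [])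
          (Runs.pop_true' (R := mk [] (Complexity.ones 0) (Complexity.ones (t + 1)) [] (Complexity.ones v)) _ _ rfl (update_b ..) (runs_found ..))).mono
          (show (1 + (1 + (1 + 1)) + 2) + 2 ≤ 8 by norm_num)
    · simpa [updOut, Complexity.boolPair, ones_succ] using (Runs.pop_true' (R := mk [] (Complexity.ones (f + 1)) (Complexity.ones t) [] (Complexity.ones v)) _ _ rfl
        (update_a ..) (runs_found ..)).mono (show (1 + (1 + (1 + 1))) + 2 ≤ 8 by norm_num)
  refine ⟨_, (h1.seq (h2.seq h3)).mono (by omega), ?_⟩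
  simp only [mk_out]
  rw [hf, ht, hv]

end LPH.UPD

/-- **The function computed by the update program.** [folklore] -/
def updFn (w : List Bool) : List Bool := LPH.UPD.updOut (Complexity.Com.spec3 w 0)

/-- **`updFn ∈ FP`.** [cite: AroraBarakCC2009, §1.3] -/
theorem updFn_mem_FP : updFn ∈ Complexity.FP :=
  Complexity.Com.mem_FP LPH.UPD.prog LPH.UPD.Rg.inp LPH.UPD.Rg.out (8 * Polynomial.X + 14) updFn fun z => by
    obtain ⟨R', h, hout⟩ := LPH.UPD.runs_prog z
    exact ⟨R', Or.inl (by simpa using h), hout⟩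

/-- **`updFn ⟨1ᶠ, ⟨1ᵗ, 1ᵛ⟩⟩`**: frozen `⟨1¹, 1ᵛ⟩` if `f ≠ 0` or `t ≠ 0`, else searching `⟨1⁰, 1ᵛ⁺¹⟩`. [folklore] -/
theorem updFn_boolPair (f t v : ℕ) :
    updFn (Complexity.boolPair (Complexity.ones f) (Complexity.boolPair (Complexity.ones t) (Complexity.ones v))) =
      if f = 0 ∧ t = 0 then Complexity.boolPair (Complexity.ones 0) (Complexity.ones (v + 1)) else Complexity.boolPair (Complexity.ones 1) (Complexity.ones v) := by
  simp [updFn, Complexity.Com.spec3_boolPair, LPH.UPD.updOut]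

/-! ### The output `⟨1ᶠ, ⟨1ᵛ, 1ⁿ⟩⟩ ↦ encodeNat (if f ≠ 0 then v else n + c + 1)` -/

namespace LPH.OUT

open Complexity.Com

/-- Registers of the output program: input, the three counters, the selected result in unary, the
numeral and the increment scratch. [folklore] -/
inductive Rg
  | inp | a | b | c | res | nb | t | t2 | fl
  deriving DecidableEq, Fintype

/-- Explicit register files. [folklore] -/
def mk (zi za zb zc zr zn zt zt2 zf : List Bool) : Complexity.Regs Rg := fun r =>
  match r with
  | .inp => zi | .a => za | .b => zb | .c => zc | .res => zr | .nb => zn | .t => zt | .t2 => zt2 | .fl => zf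

section MkLemmas
variable (zi za zb zc zr zn zt zt2 zf x : List Bool)
/-- Reading `inp`. [folklore] -/
@[simp] theorem mk_inp : mk zi za zb zc zr zn zt zt2 zf .inp = zi := rfl
/-- Reading `a`. [folklore] -/
@[simp] theorem mk_a : mk zi za zb zc zr zn zt zt2 zf .a = za := rfl
/-- Reading `b`. [folklore] -/
@[simp] theorem mk_b : mk zi za zb zc zr zn zt zt2 zf .b = zb := rfl
/-- Reading `c`. [folklore] -/
@[simp] theorem mk_c : mk zi za zb zc zr zn zt zt2 zf .c = zc := rfl
/-- Reading `res`. [folklore] -/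
@[simp] theorem mk_res : mk zi za zb zc zr zn zt zt2 zf .res = zr := rfl
/-- Reading `nb`. [folklore] -/
@[simp] theorem mk_nb : mk zi za zb zc zr zn zt zt2 zf .nb = zn := rfl
/-- Reading `t`. [folklore] -/
@[simp] theorem mk_t : mk zi za zb zc zr zn zt zt2 zf .t = zt := rfl
/-- Reading `t2`. [folklore] -/
@[simp] theorem mk_t2 : mk zi za zb zc zr zn zt zt2 zf .t2 = zt2 := rfl
/-- Reading `fl`. [folklore] -/
@[simp] theorem mk_fl : mk zi za zb zc zr zn zt zt2 zf .fl = zf := rfl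
/-- Updating `inp`. [folklore] -/
@[simp] theorem update_inp : Function.update (mk zi za zb zc zr zn zt zt2 zf) .inp x = mk x za zb zc zr zn zt zt2 zf := by
  funext r; cases r <;> simp
/-- Updating `a`. [folklore] -/
@[simp] theorem update_a : Function.update (mk zi za zb zc zr zn zt zt2 zf) .a x = mk zi x zb zc zr zn zt zt2 zf := by
  funext r; cases r <;> simp
/-- Updating `b`. [folklore] -/
@[simp] theorem update_b : Function.update (mk zi za zb zc zr zn zt zt2 zf) .b x = mk zi za x zc zr zn zt zt2 zf := by
  funext r; cases r <;> simp
/-- Updating `c`. [folklore] -/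
@[simp] theorem update_c : Function.update (mk zi za zb zc zr zn zt zt2 zf) .c x = mk zi za zb x zr zn zt zt2 zf := by
  funext r; cases r <;> simp
/-- Updating `res`. [folklore] -/
@[simp] theorem update_res : Function.update (mk zi za zb zc zr zn zt zt2 zf) .res x = mk zi za zb zc x zn zt zt2 zf := by
  funext r; cases r <;> simp
/-- Updating `nb`. [folklore] -/
@[simp] theorem update_nb : Function.update (mk zi za zb zc zr zn zt zt2 zf) .nb x = mk zi za zb zc zr x zt zt2 zf := by
  funext r; cases r <;> simp
/-- Updating `t`. [folklore] -/
@[simp] theorem update_t : Function.update (mk zi za zb zc zr zn zt zt2 zf) .t x = mk zi za zb zc zr zn x zt2 zf := by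
  funext r; cases r <;> simp
/-- Updating `t2`. [folklore] -/
@[simp] theorem update_t2 : Function.update (mk zi za zb zc zr zn zt zt2 zf) .t2 x = mk zi za zb zc zr zn zt x zf := by
  funext r; cases r <;> simp
/-- Updating `fl`. [folklore] -/
@[simp] theorem update_fl : Function.update (mk zi za zb zc zr zn zt zt2 zf) .fl x = mk zi za zb zc zr zn zt zt2 x := by
  funext r; cases r <;> simp
end MkLemmas

/-- The initial register file. [folklore] -/
theorem init_eq (z : List Bool) : Complexity.Regs.init Rg.inp z = mk z [] [] [] [] [] [] [] [] := by
  funext r; cases r <;> simp [Complexity.Regs.init, mk]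

/-- Select the result: the recorded index `v` if found, else the default `n + c + 1`. [folklore] -/
def select (cc : ℕ) : Complexity.Com Rg := pop .a (pour .b .res) (pour .b .res) (pour .c .res ;; pushK .res (cc + 1))

/-- **The output program**: parse, select, convert to binary. [folklore] -/
def prog (cc : ℕ) : Complexity.Com Rg := parse3U .inp .a .b .c ;; select cc ;; toBin .res .nb .t .t2 .fl

/-- The selected value from the parsed counters `(f, v, n)`. [folklore] -/
def outVal (cc : ℕ) (p : ℕ × ℕ × ℕ) : ℕ := if p.1 = 0 then p.2.2 + cc + 1 else p.2.1

/-- **Semantics of the output program** (cost `≤ 9 (|z| + c + 1)² + 30 (|z| + c + 1) + 8`). [folklore] -/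
theorem runs_prog (cc : ℕ) (z : List Bool) :
    ∃ R', Runs (prog cc) (Complexity.Regs.init Rg.inp z) R' (9 * (z.length + cc + 1) ^ 2 + 30 * (z.length + cc + 1) + 8) ∧
      R' .nb = encodeNat (outVal cc (spec3 z 0)) := by
  rw [init_eq]
  set f := (spec3 z 0).1 with hf
  set v := (spec3 z 0).2.1 with hv
  set n := (spec3 z 0).2.2 with hn
  have hle := spec3_le z 0
  rw [← hf, ← hv, ← hn, Nat.zero_add] at hle
  clear_value f v n
  have h1 : Runs (parse3U .inp .a .b .c) (mk z [] [] [] [] [] [] [] []) (mk [] (Complexity.ones f) (Complexity.ones v) (Complexity.ones n) [] [] [] [] []) (5 * z.length + 5) := by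
    have := runs_parse3U (inp := Rg.inp) (a := Rg.a) (b := Rg.b) (c := Rg.c) (by decide) (by decide) (by decide) (by decide)
      (by decide) (by decide) z 0 (mk z [] [] [] [] [] [] [] []) rfl rfl rfl rfl
    rw [← hf, ← hv, ← hn] at this
    simpa using this
  set U := outVal cc (f, v, n) with hU
  have h2 : Runs (select cc) (mk [] (Complexity.ones f) (Complexity.ones v) (Complexity.ones n) [] [] [] [] [])
      (mk [] (Complexity.ones (f - 1)) (if f = 0 then Complexity.ones v else []) (if f = 0 then [] else Complexity.ones n) (Complexity.ones U) [] [] [] []) (3 * (v + n) + cc + 4) := by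
    unfold select
    rcases f with _ | f
    · have hp : Runs (pour .c .res) (mk [] (Complexity.ones 0) (Complexity.ones v) (Complexity.ones n) [] [] [] [] []) (mk [] (Complexity.ones 0) (Complexity.ones v) [] (Complexity.ones n) [] [] [] []) (3 * n + 1) := by
        have := runs_pour (a := Rg.c) (b := Rg.res) (by decide) (mk [] (Complexity.ones 0) (Complexity.ones v) (Complexity.ones n) [] [] [] [] [])
        simpa using this
      have hk : Runs (pushK .res (cc + 1)) (mk [] (Complexity.ones 0) (Complexity.ones v) [] (Complexity.ones n) [] [] [] []) (mk [] (Complexity.ones 0) (Complexity.ones v) [] (Complexity.ones (n + cc + 1)) [] [] [] []) (cc + 1) := by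
        have := runs_pushK Rg.res (cc + 1) (mk [] (Complexity.ones 0) (Complexity.ones v) [] (Complexity.ones n) [] [] [] [])
        rw [show n + cc + 1 = (cc + 1) + n by ring, ← ones_append]
        simpa using this
      simpa [hU, outVal] using (Runs.pop_nil _ _ (rfl : mk [] (Complexity.ones 0) (Complexity.ones v) (Complexity.ones n) [] [] [] [] [] .a = []) (hp.seq hk)).mono
        (show (3 * n + 1 + (cc + 1)) + 2 ≤ 3 * (v + n) + cc + 4 by omega)
    · have hp : Runs (pour .b .res) (mk [] (Complexity.ones f) (Complexity.ones v) (Complexity.ones n) [] [] [] [] []) (mk [] (Complexity.ones f) [] (Complexity.ones n) (Complexity.ones v) [] [] [] []) (3 * v + 1) := by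
        have := runs_pour (a := Rg.b) (b := Rg.res) (by decide) (mk [] (Complexity.ones f) (Complexity.ones v) (Complexity.ones n) [] [] [] [] [])
        simpa using this
      simpa [hU, outVal, ones_succ] using (Runs.pop_true' (R := mk [] (Complexity.ones (f + 1)) (Complexity.ones v) (Complexity.ones n) [] [] [] [] []) _ _ rfl
        (update_a ..) hp).mono (show 3 * v + 1 + 2 ≤ 3 * (v + n) + cc + 4 by omega)
  have h3 : Runs (toBin .res .nb .t .t2 .fl) (mk [] (Complexity.ones (f - 1)) (if f = 0 then Complexity.ones v else []) (if f = 0 then [] else Complexity.ones n) (Complexity.ones U) [] [] [] [])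
      (mk [] (Complexity.ones (f - 1)) (if f = 0 then Complexity.ones v else []) (if f = 0 then [] else Complexity.ones n) [] (encodeNat U) [] [] []) (U * (9 * (0 + U) + 16) + 1) := by
    have := runs_toBin (u := Rg.res) (B := Rg.nb) (t := Rg.t) (t2 := Rg.t2) (fl := Rg.fl) (by decide) (by decide) (by decide) (by decide)
      (by decide) (by decide) (by decide) (by decide) (by decide) (by decide) U 0
      (mk [] (Complexity.ones (f - 1)) (if f = 0 then Complexity.ones v else []) (if f = 0 then [] else Complexity.ones n) (Complexity.ones U) [] [] [] []) rfl (by simp; rfl) rfl rfl rfl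
    rw [Nat.zero_add] at this
    simpa using this
  refine ⟨_, (h1.seq (h2.seq h3)).mono ?_, by simp only [mk_nb, hU, hf, hv, hn]⟩
  have hUle : U ≤ z.length + cc + 1 := by
    rw [hU, outVal]; split_ifs <;> simp <;> omega
  have e : U * (9 * (0 + U) + 16) ≤ (z.length + cc + 1) * (9 * (z.length + cc + 1) + 16) := Nat.mul_le_mul hUle (by omega)
  have e2 : (z.length + cc + 1) * (9 * (z.length + cc + 1) + 16) = 9 * (z.length + cc + 1) ^ 2 + 16 * (z.length + cc + 1) := by ring
  omega

end LPH.OUT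

/-- **The function computed by the output program.** [folklore] -/
def outFn (cc : ℕ) (w : List Bool) : List Bool := encodeNat (LPH.OUT.outVal cc (Complexity.Com.spec3 w 0))

/-- **`outFn c ∈ FP`.** [cite: AroraBarakCC2009, §1.3] -/
theorem outFn_mem_FP (cc : ℕ) : outFn cc ∈ Complexity.FP :=
  Complexity.Com.mem_FP (LPH.OUT.prog cc) LPH.OUT.Rg.inp LPH.OUT.Rg.nb
    (9 * (Polynomial.X + Polynomial.C (cc + 1)) ^ 2 + 30 * (Polynomial.X + Polynomial.C (cc + 1)) + 8) (outFn cc) fun z => by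
    obtain ⟨R', h, hout⟩ := LPH.OUT.runs_prog cc z
    refine ⟨R', Or.inl (h.mono (le_of_eq ?_)), hout⟩
    simp [add_assoc]

/-- **`outFn c ⟨1ᶠ, ⟨1ᵛ, 1ⁿ⟩⟩ = encodeNat (if f = 0 then n + c + 1 else v)`.** [folklore] -/
theorem outFn_boolPair (cc f v n : ℕ) :
    outFn cc (Complexity.boolPair (Complexity.ones f) (Complexity.boolPair (Complexity.ones v) (Complexity.ones n))) = encodeNat (if f = 0 then n + cc + 1 else v) := by
  simp [outFn, Complexity.Com.spec3_boolPair, LPH.OUT.outVal]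

/-! ### The one-state transducer `[b] ↦ 1^{[b]}` -/

/-- The transducer erasing `0`s: on `[b]` it leaves `1^{[b]}`, turning a decision bit into a unary
flag. [folklore] -/
def unitFST : Complexity.FST Unit Bool Bool where
  init := ()
  step _ b := ((), bif b then [true] else [])
  front _ := []
  keep _ := true

/-- `unitFn w`: the `1`s of `w`. [folklore] -/
def unitFn (w : List Bool) : List Bool := Complexity.ones (w.count true)

/-- The run of `unitFST`. [folklore] -/
theorem unitFST_run (z : List Bool) : unitFST.run () z = ((), unitFn z) := by
  induction z with
  | nil => rfl
  | cons b z ih =>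
    rw [Complexity.FST.run_cons]
    cases b
    · simp [unitFST, unitFn] at ih ⊢; rw [ih]
    · simp [unitFST, unitFn] at ih ⊢; rw [ih]; simp [Complexity.ones, List.replicate_succ]

/-- `unitFST` computes `unitFn`. [folklore] -/
theorem unitFST_eval : unitFST.eval = unitFn := by
  funext z; rw [Complexity.FST.eval, show unitFST.init = () from rfl, unitFST_run]; simp [unitFST]

/-- `unitFn ∈ FP`. [folklore] -/
theorem unitFn_mem_FP : unitFn ∈ Complexity.FP := by rw [← unitFST_eval]; exact unitFST.polyTimeComputable_eval

/-- `unitFn [b] = 1^{[b]}`. [folklore] -/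
@[simp] theorem unitFn_singleton (b : Bool) : unitFn [b] = Complexity.ones (if b then 1 else 0) := by
  cases b <;> simp [unitFn]

/-! ### The base input length `lpBase c n`: an upward search with incremental `Nat.size` -/

/-- `Nat.size` at a successor: it grows exactly at the powers of two. [folklore] -/
theorem size_succ_eq (k : ℕ) : Nat.size (k + 1) = if k + 1 = 2 ^ Nat.size k then Nat.size k + 1 else Nat.size k := by
  split_ifs with h
  · rw [h, Nat.size_pow]
  · apply le_antisymm
    · have := Nat.lt_size_self k
      exact Nat.size_le.2 (by omega)
    · exact Nat.size_le_size (Nat.le_succ k)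

namespace LPH.INIT

open Complexity.Com

/-- Registers of the search program: input, fuel, the current length `k`, the countdown to the next
power of two, the countdown `(n + c) - (k - size k)`, the found flag, the result, scratch. [folklore] -/
inductive Rg
  | inp | fu | k | cd | g | fd | res | t
  deriving DecidableEq, Fintype

/-- Explicit register files. [folklore] -/
def mk (zi zf zk zc zg zd zr zt : List Bool) : Complexity.Regs Rg := fun r =>
  match r with
  | .inp => zi | .fu => zf | .k => zk | .cd => zc | .g => zg | .fd => zd | .res => zr | .t => zt

section MkLemmas
variable (zi zf zk zc zg zd zr zt x : List Bool)
/-- Reading `inp`. [folklore] -/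
@[simp] theorem mk_inp : mk zi zf zk zc zg zd zr zt .inp = zi := rfl
/-- Reading `fu`. [folklore] -/
@[simp] theorem mk_fu : mk zi zf zk zc zg zd zr zt .fu = zf := rfl
/-- Reading `k`. [folklore] -/
@[simp] theorem mk_k : mk zi zf zk zc zg zd zr zt .k = zk := rfl
/-- Reading `cd`. [folklore] -/
@[simp] theorem mk_cd : mk zi zf zk zc zg zd zr zt .cd = zc := rfl
/-- Reading `g`. [folklore] -/
@[simp] theorem mk_g : mk zi zf zk zc zg zd zr zt .g = zg := rfl
/-- Reading `fd`. [folklore] -/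
@[simp] theorem mk_fd : mk zi zf zk zc zg zd zr zt .fd = zd := rfl
/-- Reading `res`. [folklore] -/
@[simp] theorem mk_res : mk zi zf zk zc zg zd zr zt .res = zr := rfl
/-- Reading `t`. [folklore] -/
@[simp] theorem mk_t : mk zi zf zk zc zg zd zr zt .t = zt := rfl
/-- Updating `inp`. [folklore] -/
@[simp] theorem update_inp : Function.update (mk zi zf zk zc zg zd zr zt) .inp x = mk x zf zk zc zg zd zr zt := by
  funext r; cases r <;> simp
/-- Updating `fu`. [folklore] -/
@[simp] theorem update_fu : Function.update (mk zi zf zk zc zg zd zr zt) .fu x = mk zi x zk zc zg zd zr zt := by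
  funext r; cases r <;> simp
/-- Updating `k`. [folklore] -/
@[simp] theorem update_k : Function.update (mk zi zf zk zc zg zd zr zt) .k x = mk zi zf x zc zg zd zr zt := by
  funext r; cases r <;> simp
/-- Updating `cd`. [folklore] -/
@[simp] theorem update_cd : Function.update (mk zi zf zk zc zg zd zr zt) .cd x = mk zi zf zk x zg zd zr zt := by
  funext r; cases r <;> simp
/-- Updating `g`. [folklore] -/
@[simp] theorem update_g : Function.update (mk zi zf zk zc zg zd zr zt) .g x = mk zi zf zk zc x zd zr zt := by
  funext r; cases r <;> simp
/-- Updating `fd`. [folklore] -/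
@[simp] theorem update_fd : Function.update (mk zi zf zk zc zg zd zr zt) .fd x = mk zi zf zk zc zg x zr zt := by
  funext r; cases r <;> simp
/-- Updating `res`. [folklore] -/
@[simp] theorem update_res : Function.update (mk zi zf zk zc zg zd zr zt) .res x = mk zi zf zk zc zg zd x zt := by
  funext r; cases r <;> simp
/-- Updating `t`. [folklore] -/
@[simp] theorem update_t : Function.update (mk zi zf zk zc zg zd zr zt) .t x = mk zi zf zk zc zg zd zr x := by
  funext r; cases r <;> simp
end MkLemmas

/-- The initial register file. [folklore] -/
theorem init_eq (z : List Bool) : Complexity.Regs.init Rg.inp z = mk z [] [] [] [] [] [] [] := by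
  funext r; cases r <;> simp [Complexity.Regs.init, mk]

/-! #### Set-up: fuel `2(n+c)+3`, countdown `n + c`, distance `1` to the next power of two -/

/-- Per input bit: two units of fuel, one unit of `g`. [folklore] -/
def scanBody : Complexity.Com Rg := push .fu true ;; push .fu true ;; push .g true

/-- Count the input. [folklore] -/
def scan : Complexity.Com Rg := loop .inp scanBody scanBody

/-- The set-up for the constant `c`. [folklore] -/
def setup (cc : ℕ) : Complexity.Com Rg := scan ;; pushK .fu (2 * cc + 3) ;; pushK .g cc ;; push .cd true

/-- Semantics of `scan` (cost `5|w| + 1`). [folklore] -/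
theorem runs_scan : ∀ (w : List Bool) (F G : ℕ) (zk zc zd zr zt : List Bool),
    Runs scan (mk w (Complexity.ones F) zk zc (Complexity.ones G) zd zr zt) (mk [] (Complexity.ones (2 * w.length + F)) zk zc (Complexity.ones (w.length + G)) zd zr zt)
      (5 * w.length + 1)
  | [], F, G, zk, zc, zd, zr, zt => by
    have h : Runs scan (mk [] (Complexity.ones F) zk zc (Complexity.ones G) zd zr zt) (mk [] (Complexity.ones F) zk zc (Complexity.ones G) zd zr zt) 1 := Runs.loop_nil (k := Rg.inp) _ _ rfl
    simpa using h
  | b :: w, F, G, zk, zc, zd, zr, zt => by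
    have hbody : Runs scanBody (mk w (Complexity.ones F) zk zc (Complexity.ones G) zd zr zt) (mk w (Complexity.ones (F + 2)) zk zc (Complexity.ones (G + 1)) zd zr zt) (1 + (1 + 1)) := by
      simpa [scanBody, ones_succ] using (Runs.push Rg.fu true (mk w (Complexity.ones F) zk zc (Complexity.ones G) zd zr zt)).seq
        ((Runs.push Rg.fu true _).seq (Runs.push Rg.g true _))
    have ih := runs_scan w (F + 2) (G + 1) zk zc zd zr zt
    rw [show 2 * w.length + (F + 2) = 2 * (b :: w).length + F by simp; ring, show w.length + (G + 1) = (b :: w).length + G by simp; ring] at ih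
    rw [show 5 * (b :: w).length + 1 = (1 + (1 + 1)) + 2 + (5 * w.length + 1) by simp; ring]
    cases b
    · exact Runs.loop_false' (R := mk (false :: w) (Complexity.ones F) zk zc (Complexity.ones G) zd zr zt) rfl (update_inp ..) hbody ih
    · exact Runs.loop_true' (R := mk (true :: w) (Complexity.ones F) zk zc (Complexity.ones G) zd zr zt) rfl (update_inp ..) hbody ih

/-- **Semantics of the set-up** (cost `5n + 3c + 5`). [folklore] -/
theorem runs_setup (cc : ℕ) (z : List Bool) :
    Runs (setup cc) (mk z [] [] [] [] [] [] []) (mk [] (Complexity.ones (2 * (z.length + cc) + 3)) [] (Complexity.ones 1) (Complexity.ones (z.length + cc)) [] [] [])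
      (5 * z.length + 3 * cc + 5) := by
  have h1 := runs_scan z 0 0 [] [] [] [] []
  simp only [Nat.add_zero] at h1
  have h2 : Runs (pushK .fu (2 * cc + 3)) (mk [] (Complexity.ones (2 * z.length)) [] [] (Complexity.ones z.length) [] [] [])
      (mk [] (Complexity.ones (2 * (z.length + cc) + 3)) [] [] (Complexity.ones z.length) [] [] []) (2 * cc + 3) := by
    have := runs_pushK Rg.fu (2 * cc + 3) (mk [] (Complexity.ones (2 * z.length)) [] [] (Complexity.ones z.length) [] [] [])
    simp only [mk_fu, ones_append] at this
    rw [show 2 * cc + 3 + 2 * z.length = 2 * (z.length + cc) + 3 by ring] at this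
    simpa using this
  have h3 : Runs (pushK .g cc) (mk [] (Complexity.ones (2 * (z.length + cc) + 3)) [] [] (Complexity.ones z.length) [] [] [])
      (mk [] (Complexity.ones (2 * (z.length + cc) + 3)) [] [] (Complexity.ones (z.length + cc)) [] [] []) cc := by
    have := runs_pushK Rg.g cc (mk [] (Complexity.ones (2 * (z.length + cc) + 3)) [] [] (Complexity.ones z.length) [] [] [])
    simp only [mk_g, ones_append] at this
    rw [Nat.add_comm cc] at this
    simpa using this
  have h4 : Runs (push .cd true) (mk [] (Complexity.ones (2 * (z.length + cc) + 3)) [] [] (Complexity.ones (z.length + cc)) [] [] [])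
      (mk [] (Complexity.ones (2 * (z.length + cc) + 3)) [] (Complexity.ones 1) (Complexity.ones (z.length + cc)) [] [] []) 1 := Runs.push' (update_cd ..)
  exact (h1.seq (h2.seq (h3.seq h4))).mono (by omega)

/-! #### One step of the search -/

/-- Raise the found flag (idempotently). [folklore] -/
def setFound : Complexity.Com Rg := pop .fd (push .fd true) (push .fd true) (push .fd true)

/-- Hit test: the countdown `g` is exhausted iff `k - size k ≥ n + c`. [folklore] -/
def testHit : Complexity.Com Rg := pop .g (push .g true) (push .g true) setFound

/-- Advance the result with `k` while nothing is found. [folklore] -/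
def advRes : Complexity.Com Rg := pop .fd (push .fd true) (push .fd true) (push .res true)

/-- Advance `k`: decrement the distance to the next power of two; at a power of two reload it
with `k` (then `size` grew and `k - size k` did not), otherwise count `g` down. [folklore] -/
def advK : Complexity.Com Rg :=
  push .k true ;; pop .cd skip skip skip ;;
  pop .cd (push .cd true ;; pop .g skip skip skip) (push .cd true ;; pop .g skip skip skip) (addReg .k .cd .t)

/-- The body of the search loop. [folklore] -/
def body : Complexity.Com Rg := testHit ;; advRes ;; advK

/-- The search loop, driven by the fuel. [folklore] -/
def search : Complexity.Com Rg := loop .fu body body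

/-- **The base-length program** for the constants `c`, `j`: `res := 1^{lpBase c n + j}`. [folklore] -/
def prog (cc j : ℕ) : Complexity.Com Rg := setup cc ;; search ;; pushK .res j

/-- The arithmetic state of the search: `(k, cd, g, f, res)`. [folklore] -/
structure St where
  /-- the current length `k` -/
  k : ℕ
  /-- distance to the next power of two, `2^{size k} - k` -/
  cd : ℕ
  /-- the countdown `(n + c) - (k - size k)` -/
  g : ℕ
  /-- found flag, `0` or `1` -/
  f : ℕ
  /-- the result so far -/
  res : ℕ

/-- One step of the search on the arithmetic state. [folklore] -/
def stepS (s : St) : St :=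
  let f' := if s.g = 0 then 1 else s.f
  let res' := if f' = 0 then s.res + 1 else s.res
  if s.cd - 1 = 0 then ⟨s.k + 1, s.k + 1, s.g, f', res'⟩ else ⟨s.k + 1, s.cd - 1, s.g - 1, f', res'⟩

/-- The iterated search. [folklore] -/
def searchN : ℕ → St → St
  | 0, s => s
  | F + 1, s => searchN F (stepS s)

/-- The register file of an arithmetic state (flag as a unary word of length `f ≤ 1`). [folklore] -/
def regs (zi : List Bool) (F : ℕ) (s : St) : Complexity.Regs Rg := mk zi (Complexity.ones F) (Complexity.ones s.k) (Complexity.ones s.cd) (Complexity.ones s.g) (Complexity.ones s.f) (Complexity.ones s.res) []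

/-- Semantics of `testHit` (cost `≤ 5`): on `g = 0` the flag becomes `1`. [folklore] -/
theorem runs_testHit (zi : List Bool) (F K CD G f RES : ℕ) (hf : f ≤ 1) :
    Runs testHit (mk zi (Complexity.ones F) (Complexity.ones K) (Complexity.ones CD) (Complexity.ones G) (Complexity.ones f) (Complexity.ones RES) [])
      (mk zi (Complexity.ones F) (Complexity.ones K) (Complexity.ones CD) (Complexity.ones G) (Complexity.ones (if G = 0 then 1 else f)) (Complexity.ones RES) []) 5 := by
  unfold testHit setFound
  rcases G with _ | G
  · rcases f with _ | f
    · simpa using (Runs.pop_nil _ _ (rfl : mk zi (Complexity.ones F) (Complexity.ones K) (Complexity.ones CD) (Complexity.ones 0) (Complexity.ones 0) (Complexity.ones RES) [] .g = [])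
        (Runs.pop_nil _ _ (rfl : mk zi (Complexity.ones F) (Complexity.ones K) (Complexity.ones CD) (Complexity.ones 0) (Complexity.ones 0) (Complexity.ones RES) [] .fd = []) (Runs.push' (update_fd ..)))).mono
        (show 1 + 2 + 2 ≤ 5 by norm_num)
    · obtain rfl : f = 0 := by omega
      simpa [ones_succ] using (Runs.pop_nil _ _ (rfl : mk zi (Complexity.ones F) (Complexity.ones K) (Complexity.ones CD) (Complexity.ones 0) (Complexity.ones 1) (Complexity.ones RES) [] .g = [])
        (Runs.pop_true' (R := mk zi (Complexity.ones F) (Complexity.ones K) (Complexity.ones CD) (Complexity.ones 0) (Complexity.ones 1) (Complexity.ones RES) []) _ _ rfl (update_fd ..)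
          (Runs.push' (update_fd ..)))).mono (show 1 + 2 + 2 ≤ 5 by norm_num)
  · simpa [ones_succ] using (Runs.pop_true' (R := mk zi (Complexity.ones F) (Complexity.ones K) (Complexity.ones CD) (Complexity.ones (G + 1)) (Complexity.ones f) (Complexity.ones RES) []) _ _ rfl
      (update_g ..) (Runs.push' (update_g ..))).mono (show 1 + 2 ≤ 5 by norm_num)

/-- Semantics of `advRes` (cost `≤ 3`). [folklore] -/
theorem runs_advRes (zi : List Bool) (F K CD G f RES : ℕ) (hf : f ≤ 1) :
    Runs advRes (mk zi (Complexity.ones F) (Complexity.ones K) (Complexity.ones CD) (Complexity.ones G) (Complexity.ones f) (Complexity.ones RES) [])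
      (mk zi (Complexity.ones F) (Complexity.ones K) (Complexity.ones CD) (Complexity.ones G) (Complexity.ones f) (Complexity.ones (if f = 0 then RES + 1 else RES)) []) 3 := by
  unfold advRes
  rcases f with _ | f
  · simpa [ones_succ] using Runs.pop_nil _ _ (rfl : mk zi (Complexity.ones F) (Complexity.ones K) (Complexity.ones CD) (Complexity.ones G) (Complexity.ones 0) (Complexity.ones RES) [] .fd = [])
      (Runs.push' (update_res ..))
  · obtain rfl : f = 0 := by omega
    simpa [ones_succ] using Runs.pop_true' (R := mk zi (Complexity.ones F) (Complexity.ones K) (Complexity.ones CD) (Complexity.ones G) (Complexity.ones 1) (Complexity.ones RES) []) _ _ rfl (update_fd ..)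
      (Runs.push' (update_fd ..))

/-- Semantics of `advK` (cost `≤ 7K + 16`), for a positive distance `cd`. [folklore] -/
theorem runs_advK (zi : List Bool) (F K CD G f RES : ℕ) (_hcd : 1 ≤ CD) :
    Runs advK (mk zi (Complexity.ones F) (Complexity.ones K) (Complexity.ones CD) (Complexity.ones G) (Complexity.ones f) (Complexity.ones RES) [])
      (mk zi (Complexity.ones F) (Complexity.ones (K + 1)) (Complexity.ones (if CD - 1 = 0 then K + 1 else CD - 1)) (Complexity.ones (if CD - 1 = 0 then G else G - 1)) (Complexity.ones f) (Complexity.ones RES) [])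
      (7 * K + 16) := by
  unfold advK
  have h1 : Runs (push .k true) (mk zi (Complexity.ones F) (Complexity.ones K) (Complexity.ones CD) (Complexity.ones G) (Complexity.ones f) (Complexity.ones RES) [])
      (mk zi (Complexity.ones F) (Complexity.ones (K + 1)) (Complexity.ones CD) (Complexity.ones G) (Complexity.ones f) (Complexity.ones RES) []) 1 := Runs.push' (update_k ..)
  have h2 : Runs (pop .cd skip skip skip) (mk zi (Complexity.ones F) (Complexity.ones (K + 1)) (Complexity.ones CD) (Complexity.ones G) (Complexity.ones f) (Complexity.ones RES) [])
      (mk zi (Complexity.ones F) (Complexity.ones (K + 1)) (Complexity.ones (CD - 1)) (Complexity.ones G) (Complexity.ones f) (Complexity.ones RES) []) 2 := by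
    have := runs_pop1 Rg.cd (mk zi (Complexity.ones F) (Complexity.ones (K + 1)) (Complexity.ones CD) (Complexity.ones G) (Complexity.ones f) (Complexity.ones RES) [])
    simpa [drop_ones] using this
  refine (h1.seq (h2.seq ?_)).mono (show 1 + (2 + (7 * K + 13)) ≤ 7 * K + 16 by omega)
  rcases hCD : CD - 1 with _ | C
  · -- reload the distance with `k`
    have := runs_addReg (p := Rg.k) (v := Rg.cd) (t := Rg.t) (by decide) (by decide) (by decide)
      (mk zi (Complexity.ones F) (Complexity.ones (K + 1)) (Complexity.ones 0) (Complexity.ones G) (Complexity.ones f) (Complexity.ones RES) []) rfl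
    simp only [mk_k, mk_cd, List.length_replicate] at this
    simpa using (Runs.pop_nil _ _ (rfl : mk zi (Complexity.ones F) (Complexity.ones (K + 1)) (Complexity.ones 0) (Complexity.ones G) (Complexity.ones f) (Complexity.ones RES) [] .cd = []) this).mono
      (show 7 * (K + 1) + 2 + 2 ≤ 7 * K + 13 by omega)
  · -- still counting down
    have hg : Runs (pop .g skip skip skip) (mk zi (Complexity.ones F) (Complexity.ones (K + 1)) (Complexity.ones (C + 1)) (Complexity.ones G) (Complexity.ones f) (Complexity.ones RES) [])
        (mk zi (Complexity.ones F) (Complexity.ones (K + 1)) (Complexity.ones (C + 1)) (Complexity.ones (G - 1)) (Complexity.ones f) (Complexity.ones RES) []) 2 := by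
      have := runs_pop1 Rg.g (mk zi (Complexity.ones F) (Complexity.ones (K + 1)) (Complexity.ones (C + 1)) (Complexity.ones G) (Complexity.ones f) (Complexity.ones RES) [])
      simpa [drop_ones] using this
    have hpg : Runs (push .cd true ;; pop .g skip skip skip) (mk zi (Complexity.ones F) (Complexity.ones (K + 1)) (Complexity.ones C) (Complexity.ones G) (Complexity.ones f) (Complexity.ones RES) [])
        (mk zi (Complexity.ones F) (Complexity.ones (K + 1)) (Complexity.ones (C + 1)) (Complexity.ones (G - 1)) (Complexity.ones f) (Complexity.ones RES) []) (1 + 2) :=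
      (Runs.push' (update_cd ..)).seq hg
    simpa [ones_succ] using (Runs.pop_true' (R := mk zi (Complexity.ones F) (Complexity.ones (K + 1)) (Complexity.ones (C + 1)) (Complexity.ones G) (Complexity.ones f) (Complexity.ones RES) []) _ _ rfl
      (update_cd ..) hpg).mono (show 1 + 2 + 2 ≤ 7 * K + 13 by omega)

/-- **Semantics of one search step** (cost `≤ 7K + 24`). [folklore] -/
theorem runs_body (zi : List Bool) (F : ℕ) (s : St) (hf : s.f ≤ 1) (hcd : 1 ≤ s.cd) :
    Runs body (regs zi F s) (regs zi F (stepS s)) (7 * s.k + 24) := by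
  obtain ⟨K, CD, G, f, RES⟩ := s
  simp only at hf hcd
  dsimp only
  have h1 := runs_testHit zi F K CD G f RES hf
  have hf' : (if G = 0 then 1 else f) ≤ 1 := by split_ifs <;> omega
  have h2 := runs_advRes zi F K CD G (if G = 0 then 1 else f) RES hf'
  have h3 := runs_advK zi F K CD G (if G = 0 then 1 else f) (if (if G = 0 then 1 else f) = 0 then RES + 1 else RES) hcd
  refine ((h1.seq (h2.seq h3)).of_eq ?_ (by omega))
  simp only [regs, stepS]
  split_ifs <;> rfl

/-- The step keeps the flag a bit and the distance positive. [folklore] -/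
theorem stepS_inv (s : St) (hf : s.f ≤ 1) (hcd : 1 ≤ s.cd) : (stepS s).f ≤ 1 ∧ 1 ≤ (stepS s).cd := by
  obtain ⟨K, CD, G, f, RES⟩ := s
  simp only at hf hcd
  unfold stepS
  dsimp only
  by_cases hc : CD - 1 = 0
  · rw [if_pos hc]
    exact ⟨by dsimp only; split_ifs <;> omega, by dsimp only; omega⟩
  · rw [if_neg hc]
    exact ⟨by dsimp only; split_ifs <;> omega, by dsimp only; omega⟩

/-- The step increments `k`. [folklore] -/
theorem stepS_k (s : St) : (stepS s).k = s.k + 1 := by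
  unfold stepS
  dsimp only
  by_cases hc : s.cd - 1 = 0
  · rw [if_pos hc]
  · rw [if_neg hc]

/-- `k` after `F` steps. [folklore] -/
theorem searchN_k : ∀ (F : ℕ) (s : St), (searchN F s).k = s.k + F
  | 0, _ => rfl
  | F + 1, s => by
    show (searchN F (stepS s)).k = s.k + (F + 1)
    rw [searchN_k F, stepS_k]; omega

/-- **Semantics of the search loop** (cost `≤ F (7 (k + F) + 26) + 1`). [folklore] -/
theorem runs_search : ∀ (F : ℕ) (s : St), s.f ≤ 1 → 1 ≤ s.cd → ∀ (zi : List Bool),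
    Runs search (regs zi F s) (regs zi 0 (searchN F s)) (F * (7 * (s.k + F) + 26) + 1)
  | 0, s, _, _, zi => by
    have h : Runs search (regs zi 0 s) (regs zi 0 s) 1 := Runs.loop_nil (k := Rg.fu) _ _ rfl
    show Runs search (regs zi 0 s) (regs zi 0 s) (0 * _ + 1)
    simpa using h
  | F + 1, s, hf, hcd, zi => by
    have hbody := runs_body zi F s hf hcd
    obtain ⟨hf', hcd'⟩ := stepS_inv s hf hcd
    have ih := runs_search F (stepS s) hf' hcd' zi
    rw [stepS_k] at ih
    simp only [searchN]
    refine (Runs.loop_true' (R := regs zi (F + 1) s) rfl (by simp [regs]) hbody ih).mono ?_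
    have : F * (7 * (s.k + 1 + F) + 26) = F * (7 * (s.k + (F + 1)) + 26) := by ring_nf
    nlinarith [this]

/-! #### Arithmetic of the search: the invariant and the least admissible length -/

/-- The hit test of the program at length `L`: `n + c ≤ L - size L` (the countdown `g` is
exhausted). [folklore] -/
def Hit (nc L : ℕ) : Prop := nc ≤ L - Nat.size L

/-- `Hit` is decidable (an inequality of naturals). [folklore] -/
instance (nc L : ℕ) : Decidable (Hit nc L) := inferInstanceAs (Decidable (_ ≤ _))

/-- The admissibility of a length `L`: `n + c + Nat.size L = L` — the tree convention of
`lpCand` (`LiuPassWeakOWF.lean`: a `Nat.size L`-bit length field); print has the single length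
`m = n + c + ⌈log(n+c)⌉` per `n`. [Y. Liu, R. Pass, FOCS 2020, proof of Thm 4.1] [folklore] -/
def Adm (nc L : ℕ) : Prop := nc + Nat.size L = L

/-- `Adm` is decidable (an equation of naturals). [folklore] -/
instance (nc L : ℕ) : Decidable (Adm nc L) := inferInstanceAs (Decidable (_ = _))

/-- The least hit below the bound `B`, else `B`. [folklore] -/
def baseLen (nc : ℕ) : ℕ → ℕ
  | 0 => 0
  | B + 1 => if baseLen nc B < B then baseLen nc B else if Hit nc B then B else B + 1

/-- `baseLen nc B ≤ B`. [folklore] -/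
theorem baseLen_le (nc : ℕ) : ∀ B, baseLen nc B ≤ B
  | 0 => le_rfl
  | B + 1 => by
    rw [baseLen]; have := baseLen_le nc B; split_ifs <;> omega

/-- `baseLen nc B < B` iff some `L < B` is a hit, and then it is the least hit. [folklore] -/
theorem baseLen_spec (nc : ℕ) : ∀ B, (baseLen nc B < B ↔ ∃ L < B, Hit nc L) ∧
    (baseLen nc B < B → Hit nc (baseLen nc B) ∧ ∀ L < baseLen nc B, ¬ Hit nc L)
  | 0 => by simp [baseLen]
  | B + 1 => by
    obtain ⟨ih1, ih2⟩ := baseLen_spec nc B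
    have hle := baseLen_le nc B
    rw [baseLen]
    by_cases hlt : baseLen nc B < B
    · rw [if_pos hlt]
      obtain ⟨hA, hmin⟩ := ih2 hlt
      exact ⟨⟨fun _ => ⟨_, by omega, hA⟩, fun _ => by omega⟩, fun _ => ⟨hA, hmin⟩⟩
    · rw [if_neg hlt]
      have hnone : ∀ L < B, ¬ Hit nc L := fun L hL hAL => hlt (ih1.2 ⟨L, hL, hAL⟩)
      by_cases hB : Hit nc B
      · rw [if_pos hB]
        exact ⟨⟨fun _ => ⟨B, by omega, hB⟩, fun _ => by omega⟩, fun _ => ⟨hB, hnone⟩⟩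
      · rw [if_neg hB]
        refine ⟨⟨fun h => absurd h (by omega), ?_⟩, fun h => absurd h (by omega)⟩
        rintro ⟨L, hL, hAL⟩
        rcases Nat.lt_succ_iff_lt_or_eq.1 hL with hL | rfl
        · exact absurd hAL (hnone L hL)
        · exact absurd hAL hB

/-- `k - size k` grows by at most one per step, and exactly when `k + 1` is not a power of two.
[folklore] -/
theorem sub_size_succ (k : ℕ) : k + 1 - Nat.size (k + 1) = (k - Nat.size k) + if k + 1 = 2 ^ Nat.size k then 0 else 1 := by
  have hk := Nat.lt_size_self k
  have hs : Nat.size k ≤ k := Nat.size_le.2 (Nat.lt_two_pow_self)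
  rw [size_succ_eq]
  split_ifs with h <;> omega

/-- An admissible length is a hit. [folklore] -/
theorem Adm.hit {nc L : ℕ} (h : Adm nc L) : Hit nc L := by unfold Adm at h; unfold Hit; omega

/-- The least hit is admissible (`k - size k` does not jump over `n + c`). [folklore] -/
theorem adm_of_least_hit {nc k : ℕ} (hk : Hit nc k) (hmin : ∀ L < k, ¬ Hit nc L) : Adm nc k := by
  unfold Hit at hk; unfold Adm
  have hs : Nat.size k ≤ k := Nat.size_le.2 (Nat.lt_two_pow_self)
  rcases k with _ | k
  · simp at hk ⊢; omega
  · have h := sub_size_succ k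
    have hprev := hmin k (Nat.lt_succ_self k)
    unfold Hit at hprev
    split_ifs at h <;> omega

/-- **The least hit below `B` is the least admissible length below `B`** (and there is one iff
there is an admissible length below `B`). [folklore] -/
theorem baseLen_adm (nc B : ℕ) : (baseLen nc B < B ↔ ∃ L < B, Adm nc L) ∧
    (baseLen nc B < B → Adm nc (baseLen nc B) ∧ ∀ L < baseLen nc B, ¬ Adm nc L) := by
  obtain ⟨h1, h2⟩ := baseLen_spec nc B
  refine ⟨⟨fun h => ?_, fun ⟨L, hL, hA⟩ => h1.2 ⟨L, hL, hA.hit⟩⟩, fun h => ?_⟩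
  · obtain ⟨hH, hmin⟩ := h2 h
    exact ⟨_, h, adm_of_least_hit hH hmin⟩
  · obtain ⟨hH, hmin⟩ := h2 h
    exact ⟨adm_of_least_hit hH hmin, fun L hL hA => hmin L hL hA.hit⟩

/-- The invariant of the search from the initial state, after `k` steps. [folklore] -/
def inv (nc : ℕ) (k : ℕ) : St :=
  ⟨k, 2 ^ Nat.size k - k, nc - (k - Nat.size k), if baseLen nc k < k then 1 else 0, baseLen nc k⟩

/-- The initial state is the invariant at `0`. [folklore] -/
theorem inv_zero (nc : ℕ) : inv nc 0 = ⟨0, 1, nc, 0, 0⟩ := by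
  simp [inv, baseLen]

/-- The invariant has a bit flag and a positive distance. [folklore] -/
theorem inv_ok (nc k : ℕ) : (inv nc k).f ≤ 1 ∧ 1 ≤ (inv nc k).cd := by
  have hk := Nat.lt_size_self k
  simp only [inv]
  constructor
  · split_ifs <;> omega
  · omega

/-- **The step preserves the invariant.** [folklore] -/
theorem stepS_inv_eq (nc k : ℕ) : stepS (inv nc k) = inv nc (k + 1) := by
  have hk := Nat.lt_size_self k
  have hs : Nat.size k ≤ k := Nat.size_le.2 (Nat.lt_two_pow_self)
  obtain ⟨hsp1, hsp2⟩ := baseLen_spec nc k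
  have hble := baseLen_le nc k
  have hsz := size_succ_eq k
  have hsub := sub_size_succ k
  have hg0 : (nc - (k - Nat.size k) = 0) ↔ Hit nc k := by unfold Hit; omega
  -- the new flag and result
  have hflag : (if nc - (k - Nat.size k) = 0 then 1 else if baseLen nc k < k then 1 else 0) =
      (if baseLen nc (k + 1) < k + 1 then 1 else 0) ∧
    (if (if nc - (k - Nat.size k) = 0 then 1 else if baseLen nc k < k then 1 else 0) = 0 then baseLen nc k + 1
        else baseLen nc k) = baseLen nc (k + 1) := by
    by_cases hlt : baseLen nc k < k
    · have hbl : baseLen nc (k + 1) = baseLen nc k := by rw [baseLen, if_pos hlt]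
      rw [hbl, if_pos (show baseLen nc k < k + 1 by omega)]
      by_cases hG : nc - (k - Nat.size k) = 0
      · rw [if_pos hG]; exact ⟨rfl, by rw [if_neg (by norm_num)]⟩
      · rw [if_neg hG, if_pos hlt]; exact ⟨rfl, by rw [if_neg (by norm_num)]⟩
    · have heq : baseLen nc k = k := by omega
      by_cases hH : Hit nc k
      · have hbl : baseLen nc (k + 1) = k := by rw [baseLen, if_neg hlt, if_pos hH]
        rw [hbl, if_pos (hg0.2 hH), if_pos (Nat.lt_succ_self k)]
        exact ⟨rfl, by rw [if_neg (by norm_num), heq]⟩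
      · have hbl : baseLen nc (k + 1) = k + 1 := by rw [baseLen, if_neg hlt, if_neg hH]
        rw [hbl, if_neg (fun h => hH (hg0.1 h)), if_neg hlt, if_neg (lt_irrefl _)]
        exact ⟨rfl, by rw [if_pos rfl, heq]⟩
  obtain ⟨hf, hres⟩ := hflag
  by_cases hpow : k + 1 = 2 ^ Nat.size k
  · have hsz' : Nat.size (k + 1) = Nat.size k + 1 := by rw [hsz, if_pos hpow]
    have hsub' : k + 1 - Nat.size (k + 1) = k - Nat.size k + 0 := by rw [hsub, if_pos hpow]
    have hc : 2 ^ Nat.size k - k - 1 = 0 := by omega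
    simp only [inv, stepS]
    rw [if_pos hc, hsub', hsz', hres, hf, pow_succ, Nat.add_zero]
    congr 1; omega
  · have hsz' : Nat.size (k + 1) = Nat.size k := by rw [hsz, if_neg hpow]
    have hsub' : k + 1 - Nat.size (k + 1) = k - Nat.size k + 1 := by rw [hsub, if_neg hpow]
    have hc : ¬ 2 ^ Nat.size k - k - 1 = 0 := by omega
    simp only [inv, stepS]
    rw [if_neg hc, hsub', hsz', hres, hf]
    congr 1

/-- **The search from the initial state runs the invariant.** [folklore] -/
theorem searchN_inv (nc : ℕ) : ∀ (F k : ℕ), searchN F (inv nc k) = inv nc (k + F)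
  | 0, k => rfl
  | F + 1, k => by rw [searchN, stepS_inv_eq, searchN_inv nc F (k + 1), Nat.add_right_comm, Nat.add_assoc]

end LPH.INIT

/-- The search bound of `lpBase`: `2(n+c)+3`. [folklore] -/
def lpBound (cc n : ℕ) : ℕ := 2 * (n + cc) + 3

/-- **The function computed by the base-length program**: `1^{baseLen (n+c) (2(n+c)+3) + j}` on an
input of length `n` — the least admissible length (else the bound) plus the slot `j`. [folklore] -/
def initLFn (cc j : ℕ) (z : List Bool) : List Bool :=
  Complexity.ones (LPH.INIT.baseLen (z.length + cc) (lpBound cc z.length) + j)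

namespace LPH.INIT

open Complexity.Com

/-- **Semantics of the whole program.** [folklore] -/
theorem runs_prog (cc j : ℕ) (z : List Bool) :
    ∃ R', Runs (prog cc j) (Complexity.Regs.init Rg.inp z) R' (40 * (z.length + cc + 2) ^ 2 + j) ∧ R' .res = initLFn cc j z := by
  rw [init_eq]
  have h1 := runs_setup cc z
  have h2 := runs_search (lpBound cc z.length) ⟨0, 1, z.length + cc, 0, 0⟩ (by simp) (by simp) []
  rw [← inv_zero, searchN_inv, Nat.zero_add] at h2
  have hstart : regs [] (lpBound cc z.length) (inv (z.length + cc) 0) =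
      mk [] (Complexity.ones (2 * (z.length + cc) + 3)) [] (Complexity.ones 1) (Complexity.ones (z.length + cc)) [] [] [] := by
    simp [regs, inv_zero, lpBound]
  rw [hstart] at h2
  have h3 : Runs (pushK .res j) (regs [] 0 (inv (z.length + cc) (lpBound cc z.length)))
      (Function.update (regs [] 0 (inv (z.length + cc) (lpBound cc z.length))) .res
        (Complexity.ones j ++ Complexity.ones (baseLen (z.length + cc) (lpBound cc z.length)))) j := by
    have := runs_pushK Rg.res j (regs [] 0 (inv (z.length + cc) (lpBound cc z.length)))
    simpa [regs, inv] using this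
  refine ⟨_, (h1.seq (h2.seq h3)).mono ?_, ?_⟩
  · simp only [inv, lpBound]
    generalize z.length = n
    have e1 : (2 * (n + cc) + 3) * (7 * (0 + (2 * (n + cc) + 3)) + 26) = 28 * (n + cc) ^ 2 + 136 * (n + cc) + 141 := by ring
    have e2 : 40 * (n + cc + 2) ^ 2 = 40 * (n + cc) ^ 2 + 160 * (n + cc) + 160 := by ring
    have e3 : (n + cc) ≤ (n + cc) ^ 2 := by nlinarith
    omega
  · simp [regs, initLFn, Nat.add_comm j]

end LPH.INIT

/-- **The base length of the queries is polynomial time**: `initLFn c j ∈ FP`. [cite: AroraBarakCC2009, §1.3] -/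
theorem initLFn_mem_FP (cc j : ℕ) : initLFn cc j ∈ Complexity.FP :=
  Complexity.Com.mem_FP (LPH.INIT.prog cc j) LPH.INIT.Rg.inp LPH.INIT.Rg.res
    (40 * (Polynomial.X + Polynomial.C (cc + 2)) ^ 2 + Polynomial.C j) (initLFn cc j) fun z => by
    obtain ⟨R', h, hout⟩ := LPH.INIT.runs_prog cc j z
    refine ⟨R', Or.inl (h.mono (le_of_eq ?_)), hout⟩
    simp [add_assoc]

/-- **The index field of the queries is polynomial time**: `nbFn ∈ FP`. [cite: AroraBarakCC2009, §1.3] -/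
theorem nbFn_mem_FP : nbFn ∈ Complexity.FP :=
  Complexity.Com.mem_FP LPH.NB.prog LPH.NB.Rg.inp LPH.NB.Rg.out (14 * Polynomial.X ^ 2 + 40 * Polynomial.X + 12) nbFn fun z => by
    obtain ⟨R', h, hout⟩ := LPH.NB.runs_prog z
    exact ⟨R', Or.inl (by simpa using h), hout⟩

/-- **`nbFn ⟨1ᴸ, 1ⁱ⟩ = natBits (Nat.size L) i`.** [folklore] -/
theorem nbFn_boolPair (L i : ℕ) : nbFn (Complexity.boolPair (Complexity.ones L) (Complexity.ones i)) = Complexity.natBits (Nat.size L) i := by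
  simp [nbFn, Complexity.Com.spec2_boolPair]

end Literature.Computability.Cryptography
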